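import Literature.Computability.QuantumComplexity.GluedTreesThm9EmbDefs
import Literature.Computability.QuantumComplexity.GluedTreesThm9EmbBasic
import HarnessLib

/-!
# Glued trees, Theorem 9 (classical lower bound) — geometry of the embedding (rigorous Lemma 8)

This module concatenates 4 parts of the proof of `ChildsEtAl2003_thm9`, each with its own
module docstring below: part `EmbGeomA`, part `EmbGeomB`, part `EmbGeomC`, part `EmbGeomD`.
-/
/-!
# Glued trees, Theorem 9 (classical lower bound) — XIII: geometry of the embedding, generalities

Theorem-only support file for `ChildsEtAl2003_thm9` (rigorous Lemma 8, geometric half). This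
file contains the parts of the induction on expansions that do not depend on the kind of the
expanded node:

* kind lemmas (`not_isUp_of_isCross`, `not_isCross_of_tdepth_le`, `not_isUp_of_tdepth_le`,
  `upCount_eq_*`, `slotOf_adj_of_leaf_nbr`), offsets on the cycle of slots
  (`slot_int_offset_inj`);
* the invariant holds before any expansion (`geomInv_zero`);
* `geomInv_succ_of`: the invariant after one more expansion follows from the invariant before,
  facts about the two new nodes only, and the three read-slot clauses.

## References

* [ChildsEtAl2003] A. M. Childs et al., Exponential algorithmic speedup by a quantum walk,
  STOC 2003, §4, Lemma 8.
-/

open Literature.Computability.Complexity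

namespace Literature.Computability.QuantumComplexity

namespace GluedTrees

open Finset

variable {n : ℕ}

/-! ### Kinds -/

/-- A cross node is not an up node. [folklore] -/
theorem not_isUp_of_isCross {σ : CycleDatum n} {par : List ℕ} {c : ℕ → Bool} {m : ℕ}
    (h : IsCross σ par c m) : ¬ IsUp σ par c m := by
  rintro ⟨-, h1, h2⟩
  obtain ⟨-, hq, hm⟩ := h
  have := congrArg depth h2
  rw [depth_parentV, hq, hm] at this
  omega

/-- A node of the ENTRANCE tree is not an up node (valid list). [folklore] -/
theorem not_isUp_of_tdepth_le (σ : CycleDatum n) {par : List ℕ} (hval : ∀ i (h : i < par.length), par[i] ≤ 2 * i)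
    (c : ℕ → Bool) {m : ℕ} (hm : m ≤ 2 * par.length) (htd : tdepth par m ≤ n) : ¬ IsUp σ par c m := by
  rintro ⟨hm0, h1, h2⟩
  obtain ⟨-, -, -, hmove⟩ := regionA σ hval c m hm htd
  obtain ⟨hdq, hmv⟩ := hmove hm0
  rw [hmv] at h2
  have := congrArg depth h2
  rw [depth_childV hdq, depth_parentV] at this
  omega

/-- A node of the ENTRANCE tree is not a cross node (valid list). [folklore] -/
theorem not_isCross_of_tdepth_le (σ : CycleDatum n) {par : List ℕ} (hval : ∀ i (h : i < par.length), par[i] ≤ 2 * i)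
    (c : ℕ → Bool) {m : ℕ} (hm : m ≤ 2 * par.length) (htd : tdepth par m ≤ n) : ¬ IsCross σ par c m := by
  rintro ⟨hm0, h1, -⟩
  obtain ⟨-, -, -, hmove⟩ := regionA σ hval c m hm htd
  obtain ⟨hdq, -⟩ := hmove hm0
  omega

/-- The up-count of an up node (valid list). [folklore] -/
theorem upCount_eq_succ (σ : CycleDatum n) {par : List ℕ} (hval : ∀ i (h : i < par.length), par[i] ≤ 2 * i)
    (c : ℕ → Bool) {m : ℕ} (hm : m ≤ 2 * par.length) (h : IsUp σ par c m) :
    upCount σ par c m = upCount σ par c (parentOf par m) + 1 := by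
  have hm1 : 1 ≤ m := Nat.one_le_iff_ne_zero.mpr h.1
  obtain ⟨-, hlt⟩ := parentOf_lt hval hm1 hm
  rw [upCount_of_parentOf_lt σ par c h.1 (by omega), if_pos h]

/-- The up-count of a non-up node is `0`. [folklore] -/
theorem upCount_eq_zero (σ : CycleDatum n) {par : List ℕ} (hval : ∀ i (h : i < par.length), par[i] ≤ 2 * i)
    (c : ℕ → Bool) {m : ℕ} (hm : m ≤ 2 * par.length) (h : ¬ IsUp σ par c m) : upCount σ par c m = 0 := by
  rcases Nat.eq_zero_or_pos m with rfl | hm1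
  · simp
  · obtain ⟨-, hlt⟩ := parentOf_lt hval hm1 hm
    rw [upCount_of_parentOf_lt σ par c (by omega) (by omega), if_neg h]

/-- **Leaves adjacent in `G'_n(σ)` sit in consecutive slots** (`1 ≤ n`). [cite: ChildsEtAl2003, §2] -/
theorem slotOf_adj_of_leaf_nbr (hn : 1 ≤ n) (σ : CycleDatum n) {v w : Vertex n} (hv : depth v = n) (hw : depth w = n)
    (h : w ∈ (graph n σ).neighborFinset v) : slotOf σ w = slotOf σ v + 1 ∨ slotOf σ w = slotOf σ v - 1 := by
  rw [neighborFinset_of_depth_eq hn σ hv, Finset.mem_insert] at h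
  rcases h with rfl | h
  · rw [depth_parentV, hv] at hw; omega
  · have hmem : w ∈ ({cross₁ σ v, cross₂ σ v} : Finset (Vertex n)) := h
    rw [cross_pair_eq_slotVal hn σ hv, Finset.mem_insert, Finset.mem_singleton] at hmem
    rcases hmem with rfl | rfl
    · left; rw [slotOf_slotVal]
    · right; rw [slotOf_slotVal]

/-- Small integer offsets around a slot are injective: `x + d = x + d'` with `|d|, |d'| ≤ K`,
`2K < 2^{n+1}` forces `d = d'`. [folklore] -/
theorem slot_int_offset_inj {x : Slot n} {d d' : ℤ} {K : ℕ} (hK : 2 * K < 2 ^ (n + 1))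
    (hd : |d| ≤ K) (hd' : |d'| ≤ K) (h : x + (d : Slot n) = x + (d' : Slot n)) : d = d' := by
  have h1 : ((d : Slot n)) = (d' : Slot n) := add_left_cancel h
  rw [ZMod.intCast_eq_intCast_iff_dvd_sub] at h1
  obtain ⟨k, hk⟩ := h1
  have habs : |d' - d| < (2 ^ (n + 1) : ℕ) := by
    rw [abs_le] at hd hd'
    rw [abs_lt]
    push_cast
    constructor <;> nlinarith [hd.1, hd.2, hd'.1, hd'.2]
  rcases lt_trichotomy k 0 with hk0 | rfl | hk0
  · have : (d' - d) ≤ -(2 ^ (n + 1) : ℕ) := by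
      rw [hk]; push_cast
      nlinarith [show (k : ℤ) ≤ -1 from by omega, show (0 : ℤ) < 2 ^ (n + 1) from by positivity]
    rw [abs_lt] at habs
    push_cast at this habs
    linarith [habs.1]
  · simp at hk; omega
  · have : (2 ^ (n + 1) : ℕ) ≤ (d' - d) := by
      rw [hk]; push_cast
      nlinarith [show (1 : ℤ) ≤ k from by omega, show (0 : ℤ) < 2 ^ (n + 1) from by positivity]
    rw [abs_lt] at habs
    push_cast at this habs
    linarith [habs.2]

/-! ### The invariant before any expansion -/

/-- **Base case**: the invariant holds with no expansion (only the root, at the ENTRANCE, nothing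
read). [cite: ChildsEtAl2003, §4 (Lemma 8)] -/
theorem geomInv_zero (σ : CycleDatum n) (par : List ℕ) (c : ℕ → Bool) (t h : ℕ) : GeomInv σ par c t h 0 where
  nbr := fun m h1 h2 ↦ by omega
  inj := fun m hm m' hm' _ ↦ by omega
  nonA := fun m hm htd ↦ by
    obtain rfl : m = 0 := by omega
    simp at htd
  landBlk := fun L hL L' hL' _ _ hne ↦ by omega
  landA := fun L hL hc ↦ by
    obtain rfl : L = 0 := by omega
    exact absurd hc (fun h ↦ h.1 rfl)
  up := fun m hm hu ↦ by
    obtain rfl : m = 0 := by omega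
    exact absurd hu (fun h ↦ h.1 rfl)
  down := fun m hm htd ↦ by
    obtain rfl : m = 0 := by omega
    simp at htd
  readIff := fun m hm hd ↦ by
    obtain rfl : m = 0 := by omega
    rw [pos_zero, depth_entrance] at hd
    subst hd
    simp [IsCross]
  readOcc := fun s hs ↦ by simp at hs
  seg := ⟨∅, fun _ ↦ 1, fun _ ↦ 1, by simp, by simp, fun s ↦ by simp, fun m hm hc ↦ by
    obtain rfl : m = 0 := by omega
    exact absurd hc (fun h ↦ h.1 rfl)⟩

/-! ### The generic part of the induction step -/

/-- **The induction step, generic part.** The invariant after `j + 1` expansions follows from the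
invariant after `j`, the node-local clauses for the two new nodes `2j+1`, `2j+2` (moves along
edges, fresh distinct positions, kind data, landing-block clauses), and the three read-slot
clauses at `j + 1`. [cite: ChildsEtAl2003, §4 (Lemma 8)] -/
theorem geomInv_succ_of {σ : CycleDatum n} {par : List ℕ} {c : ℕ → Bool} {t h j : ℕ} (I : GeomInv σ par c t h j)
    (hnbr : ∀ m, m = 2 * j + 1 ∨ m = 2 * j + 2 →
      pos σ par c m ∈ (graph n σ).neighborFinset (pos σ par c (parentOf par m)))
    (hfresh : ∀ m, m = 2 * j + 1 ∨ m = 2 * j + 2 → ∀ m' ≤ 2 * j, pos σ par c m ≠ pos σ par c m')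
    (hdist : pos σ par c (2 * j + 1) ≠ pos σ par c (2 * j + 2))
    (hnonA : ∀ m, m = 2 * j + 1 ∨ m = 2 * j + 2 → n < tdepth par m →
      n + 1 - h ≤ depth (pos σ par c m) ∧ IsCross σ par c (land σ par c m) ∧ land σ par c m ≤ m ∧
        n < tdepth par (land σ par c m) ∧
        (land σ par c m ≠ m → ∃ i, i ≤ (m - 1) / 2 ∧ par[i]? = some (land σ par c m)) ∧
        blk h (pos σ par c m) = blk h (pos σ par c (land σ par c m)))
    (hblkOld : ∀ m, m = 2 * j + 1 ∨ m = 2 * j + 2 → IsCross σ par c m → ∀ L ≤ 2 * j, IsCross σ par c L →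
      blk h (pos σ par c m) ≠ blk h (pos σ par c L))
    (hblkNew : IsCross σ par c (2 * j + 1) → IsCross σ par c (2 * j + 2) →
      blk h (pos σ par c (2 * j + 1)) ≠ blk h (pos σ par c (2 * j + 2)))
    (hblkA : ∀ m, m = 2 * j + 1 ∨ m = 2 * j + 2 → IsCross σ par c m → ∀ a ≤ 2 * par.length, tdepth par a ≤ n →
      n + 1 - h ≤ depth (aPos (n := n) par c a) → blk h (pos σ par c m) ≠ blk h (aPos (n := n) par c a))
    (hup : ∀ m, m = 2 * j + 1 ∨ m = 2 * j + 2 → IsUp σ par c m → n < tdepth par m ∧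
      pos σ par c m = anc (pos σ par c (land σ par c m)) (upCount σ par c m) ∧
        (IsUp σ par c (parentOf par m) ∨ parentOf par m = land σ par c m))
    (hdown : ∀ m, m = 2 * j + 1 ∨ m = 2 * j + 2 → n < tdepth par m → ¬ IsCross σ par c m → ¬ IsUp σ par c m →
      depth (pos σ par c (parentOf par m)) < n ∧ parentV (pos σ par c m) = pos σ par c (parentOf par m) ∧
        depth (pos σ par c m) = depth (pos σ par c (parentOf par m)) + 1 ∧
        n < tdepth par (parentOf par m) ∧ ¬ IsCross σ par c (parentOf par m) ∧
        ∃ r, 1 ≤ r ∧ r + 1 ≤ h ∧ IsDesc (sib (pos σ par c (land σ par c m)) r) (pos σ par c m))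
    (hreadIff : ∀ m ≤ 2 * (j + 1), depth (pos σ par c m) = n →
      (slotOf σ (pos σ par c m) ∈ revSlots σ par c (j + 1) ↔ IsCross σ par c m ∨ ∃ i < j + 1, par[i]? = some m))
    (hreadOcc : ∀ s ∈ revSlots σ par c (j + 1), ∃ m ≤ 2 * (j + 1), depth (pos σ par c m) = n ∧ slotOf σ (pos σ par c m) = s)
    (hseg : ∃ (C : Finset (Slot n)) (a b : Slot n → ℕ),
      (∀ x ∈ C, 1 ≤ a x ∧ a x ≤ j + 1 + 1 ∧ 1 ≤ b x ∧ b x ≤ j + 1 + 1) ∧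
      (∀ x ∈ C, ∀ x' ∈ C, x ≠ x' → ∀ d : ℤ, |d| ≤ 2 * t + 4 → x' ≠ x + d) ∧
      (∀ s, s ∈ revSlots σ par c (j + 1) ↔ ∃ x ∈ C, ∃ d : ℤ, -(a x : ℤ) ≤ d ∧ d ≤ b x ∧ s = x + d) ∧
      (∀ m ≤ 2 * (j + 1), IsCross σ par c m → (¬ ∃ i < j + 1, par[i]? = some m) →
        ∃ x ∈ C, slotOf σ (pos σ par c m) = x + ((b x : ℕ) : ℤ) ∨ slotOf σ (pos σ par c m) = x + (-((a x : ℕ) : ℤ)))) :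
    GeomInv σ par c t h (j + 1) := by
  have hsplit : ∀ m, m ≤ 2 * (j + 1) → m ≤ 2 * j ∨ (m = 2 * j + 1 ∨ m = 2 * j + 2) := fun m hm ↦ by omega
  refine ⟨?_, ?_, ?_, ?_, ?_, ?_, ?_, hreadIff, hreadOcc, hseg⟩
  · intro m hm1 hm
    rcases hsplit m hm with h' | h'
    · exact I.nbr m hm1 h'
    · exact hnbr m h'
  · intro m hm m' hm' heq
    rcases hsplit m hm with h1 | h1 <;> rcases hsplit m' hm' with h2 | h2
    · exact I.inj m h1 m' h2 heq
    · exact absurd heq.symm (hfresh m' h2 m h1)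
    · exact absurd heq (hfresh m h1 m' h2)
    · rcases h1 with rfl | rfl <;> rcases h2 with rfl | rfl
      · rfl
      · exact absurd heq hdist
      · exact absurd heq.symm hdist
      · rfl
  · intro m hm htd
    rcases hsplit m hm with h' | h'
    · exact I.nonA m h' htd
    · exact hnonA m h' htd
  · intro L hL L' hL' hc hc' hne
    rcases hsplit L hL with h1 | h1 <;> rcases hsplit L' hL' with h2 | h2
    · exact I.landBlk L h1 L' h2 hc hc' hne
    · exact (hblkOld L' h2 hc' L h1 hc).symm
    · exact hblkOld L h1 hc L' h2 hc'
    · rcases h1 with rfl | rfl <;> rcases h2 with rfl | rfl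
      · exact absurd rfl hne
      · exact hblkNew hc hc'
      · exact (hblkNew hc' hc).symm
      · exact absurd rfl hne
  · intro L hL hc a ha htd hdeep
    rcases hsplit L hL with h' | h'
    · exact I.landA L h' hc a ha htd hdeep
    · exact hblkA L h' hc a ha htd hdeep
  · intro m hm hu
    rcases hsplit m hm with h' | h'
    · exact I.up m h' hu
    · exact hup m h' hu
  · intro m hm htd hc hu
    rcases hsplit m hm with h' | h'
    · exact I.down m h' htd hc hu
    · exact hdown m h' htd hc hu

end GluedTrees

end Literature.Computability.QuantumComplexity

/-!
# Glued trees, Theorem 9 (classical lower bound) — XIV: geometry of the embedding, inner and up expansions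

Theorem-only support file for `ChildsEtAl2003_thm9` (rigorous Lemma 8, geometric half): the
induction step of the invariant `GeomInv` for an expansion of a node that sits at an INNER
vertex entered from its parent (or is the root) — its two children go down — and for an
expansion of an UP node — one child climbs further (part (i) bounds how far), the other starts
a side branch. In both cases nothing is read and the new positions are shown fresh using the
block structure of the invariant ("excursions stay in their subtrees, subtrees of distinct
landings and of the coin-only tree are distinct").

## References

* [ChildsEtAl2003] A. M. Childs et al., Exponential algorithmic speedup by a quantum walk,
  STOC 2003, §4, Lemma 8.
-/

open Literature.Computability.Complexity

namespace Literature.Computability.QuantumComplexity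

namespace GluedTrees

open Finset

variable {n : ℕ}

section Step

variable (hn : 1 ≤ n) (σ : CycleDatum n) {par : List ℕ} (hval : ValidPar par) (c : ℕ → Bool) {t h : ℕ}
  (h2 : 2 ≤ h) (hh : h ≤ n) {j : ℕ} (hj : j < par.length) (I : GeomInv σ par c t h j)
  (hdeep : ¬ Deep σ par c h)

/-! ### The two children of the expansion -/

include hval hj in
/-- The expanded node `p = par[j]` exists and has not been expanded before. [folklore] -/
theorem step_node : par[j] ≤ 2 * j ∧ (¬ ∃ i < j, par[i]? = some par[j]) ∧ par.getD j 0 = par[j] ∧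
    parentOf par (2 * j + 1) = par[j] ∧ parentOf par (2 * j + 2) = par[j] := by
  refine ⟨hval.2 j hj, ?_, ?_, parentOf_child hj⟩
  · rintro ⟨i, hi, hpi⟩
    have h1 : par[i]'(by omega) = par[j] := by
      rw [List.getElem?_eq_getElem (by omega)] at hpi; exact Option.some.inj hpi
    have := (List.Nodup.getElem_inj_iff hval.1).mp h1
    omega
  · rw [List.getD_eq_getElem?_getD, List.getElem?_eq_getElem hj]; rfl

include hn hh hval hj I in
/-- **The two new nodes go to the two onward options**, which are distinct neighbours of the
expanded node's position (other than the entering one). [cite: ChildsEtAl2003, §4 (Game 5)] -/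
theorem step_children :
    ∃ o₀ o₁ : Vertex n,
      stepOpts σ (pos σ par c par[j]) (if par[j] = 0 then none else some (pos σ par c (parentOf par par[j]))) = [o₀, o₁] ∧
      o₀ ≠ o₁ ∧
      (pos σ par c (2 * j + 1) = o₀ ∧ pos σ par c (2 * j + 2) = o₁ ∨
        pos σ par c (2 * j + 1) = o₁ ∧ pos σ par c (2 * j + 2) = o₀) ∧
      o₀ ∈ (graph n σ).neighborFinset (pos σ par c par[j]) ∧ o₁ ∈ (graph n σ).neighborFinset (pos σ par c par[j]) := by
  obtain ⟨hp_le, -, -, -, -⟩ := step_node hval hj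
  -- two options, no repetition, all neighbours
  have hmain : (stepOpts σ (pos σ par c par[j]) (if par[j] = 0 then none else some (pos σ par c (parentOf par par[j])))).length = 2 ∧
      (stepOpts σ (pos σ par c par[j]) (if par[j] = 0 then none else some (pos σ par c (parentOf par par[j])))).Nodup ∧
      ∀ w ∈ stepOpts σ (pos σ par c par[j]) (if par[j] = 0 then none else some (pos σ par c (parentOf par par[j]))),
        w ∈ (graph n σ).neighborFinset (pos σ par c par[j]) := by
    by_cases hp0 : par[j] = 0
    · rw [if_pos hp0, hp0, pos_zero]
      obtain ⟨h1, h2, h3⟩ := stepOpts_entrance_none hn σ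
      exact ⟨h3, h2, fun w hw ↦ by rw [← h1]; exact List.mem_toFinset.mpr hw⟩
    · rw [if_neg hp0]
      have hadj : pos σ par c (parentOf par par[j]) ∈ (graph n σ).neighborFinset (pos σ par c par[j]) := by
        rw [SimpleGraph.mem_neighborFinset, SimpleGraph.adj_comm, ← SimpleGraph.mem_neighborFinset]
        exact I.nbr par[j] (Nat.one_le_iff_ne_zero.mpr hp0) hp_le
      obtain ⟨htf, hnd⟩ := stepOpts_toFinset hn σ hadj
      have hlen := length_stepOpts hn σ hadj
      have hd0 : depth (pos σ par c par[j]) ≠ 0 := by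
        by_cases htd : tdepth par par[j] ≤ n
        · obtain ⟨-, hdep, -, -⟩ := regionA σ hval.2 c par[j] (by omega) htd
          have : 1 ≤ tdepth par par[j] := by
            rw [tdepth_eq_of_valid hval.2 (Nat.one_le_iff_ne_zero.mpr hp0) (by omega)]; omega
          omega
        · obtain ⟨hdeepv, -⟩ := I.nonA par[j] hp_le (by omega)
          omega
      rw [if_neg hd0] at hlen
      exact ⟨hlen, hnd, fun w hw ↦ mem_neighborFinset_of_mem_stepOpts hn σ hadj hw⟩
  obtain ⟨hlen, hnd, hmem⟩ := hmain
  obtain ⟨o₀, o₁, hos⟩ := List.length_eq_two.mp hlen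
  rw [hos] at hnd hmem
  refine ⟨o₀, o₁, hos, by simpa using hnd, ?_, hmem o₀ (by simp), hmem o₁ (by simp)⟩
  obtain ⟨c1, c2⟩ := pos_child_eq σ hval.2 c hj
  rw [hos] at c1 c2
  cases hc : c j
  · left
    rw [hc] at c1 c2
    simp only [Bool.false_eq_true, if_false] at c1 c2
    exact ⟨c1, c2⟩
  · right
    rw [hc] at c1 c2
    simp only [if_true] at c1 c2
    exact ⟨c1, c2⟩

include hn hh hval hj I in
/-- The new positions, for a known list of options. [cite: ChildsEtAl2003, §4 (Game 5)] -/
theorem step_children_of_eq {o₀ o₁ : Vertex n}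
    (hos : stepOpts σ (pos σ par c par[j]) (if par[j] = 0 then none else some (pos σ par c (parentOf par par[j]))) = [o₀, o₁]) :
    o₀ ≠ o₁ ∧ (∀ m, m = 2 * j + 1 ∨ m = 2 * j + 2 → pos σ par c m = o₀ ∨ pos σ par c m = o₁) ∧
    (pos σ par c (2 * j + 1) = o₀ ∧ pos σ par c (2 * j + 2) = o₁ ∨ pos σ par c (2 * j + 1) = o₁ ∧ pos σ par c (2 * j + 2) = o₀) ∧
    o₀ ∈ (graph n σ).neighborFinset (pos σ par c par[j]) ∧ o₁ ∈ (graph n σ).neighborFinset (pos σ par c par[j]) := by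
  obtain ⟨o₀', o₁', hos', hne, hor, hm0, hm1⟩ := step_children hn σ hval c hh hj I
  rw [hos] at hos'
  simp only [List.cons.injEq, and_true] at hos'
  obtain ⟨rfl, rfl⟩ := hos'
  refine ⟨hne, ?_, hor, hm0, hm1⟩
  intro m hm
  rcases hm with rfl | rfl <;> rcases hor with ⟨h1, h2⟩ | ⟨h1, h2⟩
  · exact Or.inl h1
  · exact Or.inr h1
  · exact Or.inr h2
  · exact Or.inl h2

/-! ### Read slots unchanged -/

include hval hj in
/-- When the expanded node is not at a leaf, nothing is read. [cite: ChildsEtAl2003, §4 (Lemma 8 (ii))] -/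
theorem revSlots_succ_of_depth_lt (hv : depth (pos σ par c par[j]) < n) :
    revSlots σ par c (j + 1) = revSlots σ par c j := by
  obtain ⟨-, -, hpj, -⟩ := step_node hval hj
  rw [revSlots_succ, hpj, if_neg (by omega), Finset.union_empty]

include hval hj I in
/-- The three read-slot clauses of the step when nothing is read and no new node is a cross
node, given that the new positions are fresh. [cite: ChildsEtAl2003, §4 (Lemma 8 (ii))] -/
theorem step_reads_of_depth_lt (hv : depth (pos σ par c par[j]) < n)
    (hnewcross : ∀ m, m = 2 * j + 1 ∨ m = 2 * j + 2 → ¬ IsCross σ par c m)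
    (hfresh : ∀ m, m = 2 * j + 1 ∨ m = 2 * j + 2 → ∀ m' ≤ 2 * j, pos σ par c m ≠ pos σ par c m') :
    (∀ m ≤ 2 * (j + 1), depth (pos σ par c m) = n →
      (slotOf σ (pos σ par c m) ∈ revSlots σ par c (j + 1) ↔ IsCross σ par c m ∨ ∃ i < j + 1, par[i]? = some m)) ∧
    (∀ s ∈ revSlots σ par c (j + 1), ∃ m ≤ 2 * (j + 1), depth (pos σ par c m) = n ∧ slotOf σ (pos σ par c m) = s) ∧
    (∃ (C : Finset (Slot n)) (a b : Slot n → ℕ),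
      (∀ x ∈ C, 1 ≤ a x ∧ a x ≤ j + 1 + 1 ∧ 1 ≤ b x ∧ b x ≤ j + 1 + 1) ∧
      (∀ x ∈ C, ∀ x' ∈ C, x ≠ x' → ∀ d : ℤ, |d| ≤ 2 * t + 4 → x' ≠ x + d) ∧
      (∀ s, s ∈ revSlots σ par c (j + 1) ↔ ∃ x ∈ C, ∃ d : ℤ, -(a x : ℤ) ≤ d ∧ d ≤ b x ∧ s = x + d) ∧
      (∀ m ≤ 2 * (j + 1), IsCross σ par c m → (¬ ∃ i < j + 1, par[i]? = some m) →
        ∃ x ∈ C, slotOf σ (pos σ par c m) = x + ((b x : ℕ) : ℤ) ∨ slotOf σ (pos σ par c m) = x + (-((a x : ℕ) : ℤ)))) := by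
  obtain ⟨hp_le, hunexp, hpj, hq1, hq2⟩ := step_node hval hj
  have hrev := revSlots_succ_of_depth_lt σ hval c hj hv
  have hsplit : ∀ m, m ≤ 2 * (j + 1) → m ≤ 2 * j ∨ (m = 2 * j + 1 ∨ m = 2 * j + 2) := fun m hm ↦ by omega
  -- `∃ i < j+1` versus `∃ i < j` for old leaf nodes (the new index `j` expands a non-leaf)
  have hexp : ∀ m, depth (pos σ par c m) = n → ((∃ i < j + 1, par[i]? = some m) ↔ ∃ i < j, par[i]? = some m) := by
    intro m hm
    constructor
    · rintro ⟨i, hi, hpi⟩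
      rcases Nat.lt_succ_iff_lt_or_eq.mp hi with hlt | rfl
      · exact ⟨i, hlt, hpi⟩
      · exfalso
        rw [List.getElem?_eq_getElem hj] at hpi
        have : par[i] = m := Option.some.inj hpi
        rw [← this] at hm
        omega
    · rintro ⟨i, hi, hpi⟩; exact ⟨i, by omega, hpi⟩
  -- new nodes are not expanded and their slots (if leaves) are unread
  have hnewexp : ∀ m, m = 2 * j + 1 ∨ m = 2 * j + 2 → ¬ ∃ i < j + 1, par[i]? = some m := by
    rintro m hm ⟨i, hi, hpi⟩
    rw [List.getElem?_eq_getElem (by omega)] at hpi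
    have h1 : par[i] = m := Option.some.inj hpi
    have := hval.2 i (by omega)
    omega
  refine ⟨?_, ?_, ?_⟩
  · intro m hm hd
    rw [hrev]
    rcases hsplit m hm with h' | h'
    · rw [I.readIff m h' hd, hexp m hd]
    · constructor
      · intro hread
        exfalso
        obtain ⟨m', hm', hd', hx⟩ := I.readOcc _ hread
        exact hfresh m h' m' hm' (slotOf_inj σ hd hd' hx.symm)
      · rintro (hc | he)
        · exact absurd hc (hnewcross m h')
        · exact absurd he (hnewexp m h')
  · intro s hs
    rw [hrev] at hs
    obtain ⟨m, hm, hd, hx⟩ := I.readOcc s hs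
    exact ⟨m, by omega, hd, hx⟩
  · obtain ⟨C, a, b, h1, h2, h3, h4⟩ := I.seg
    refine ⟨C, a, b, fun x hx ↦ ?_, h2, fun s ↦ by rw [hrev]; exact h3 s, ?_⟩
    · obtain ⟨a1, a2, b1, b2⟩ := h1 x hx; exact ⟨a1, by omega, b1, by omega⟩
    · intro m hm hc hne
      rcases hsplit m hm with h' | h'
      · exact h4 m h' hc (fun ⟨i, hi, hpi⟩ ↦ hne ⟨i, by omega, hpi⟩)
      · exact absurd hc (hnewcross m h')

/-! ### Inner expansions -/

include hn hh hval hj I in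
/-- **Induction step for an inner expansion.** If the expanded node `p` sits at an inner vertex
`v` (depth `< n`) entered from the parent vertex of `v` (or is the root), and is a node of the
ENTRANCE tree or a down node, then its children go to the two children of `v` and the invariant
is preserved. [cite: ChildsEtAl2003, §4 (Lemma 8)] -/
theorem step_inner (hv : depth (pos σ par c par[j]) < n)
    (hu : par[j] = 0 ∨ pos σ par c (parentOf par par[j]) = parentV (pos σ par c par[j]))
    (hkind : tdepth par par[j] ≤ n ∨
      (n < tdepth par par[j] ∧ ¬ IsCross σ par c par[j] ∧ ¬ IsUp σ par c par[j])) :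
    GeomInv σ par c t h (j + 1) := by
  obtain ⟨hp_le, hunexp, hpj, hq1, hq2⟩ := step_node hval hj
  set p := par[j] with hp
  have hE : 2 * j + 2 ≤ 2 * par.length := by omega
  -- the options are the two children of `(pos σ par c p)`
  have hos : stepOpts σ (pos σ par c p) (if p = 0 then none else some (pos σ par c (parentOf par p))) =
      [childV (pos σ par c p) false, childV (pos σ par c p) true] := by
    rcases hu with hp0 | hpar
    · rw [if_pos hp0]; exact stepOpts_none hv
    · by_cases hp0 : p = 0
      · rw [if_pos hp0]; exact stepOpts_none hv
      · rw [if_neg hp0, hpar]; exact stepOpts_parentV_of_depth_lt hv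
  obtain ⟨hne, hnewpos, hor, hmem0, hmem1⟩ := step_children_of_eq hn σ hval c hh hj I hos
  -- facts about the new nodes
  have hq : ∀ m, m = 2 * j + 1 ∨ m = 2 * j + 2 → parentOf par m = p := by
    rintro m (rfl | rfl); exacts [hq1, hq2]
  have hchild : ∀ m, m = 2 * j + 1 ∨ m = 2 * j + 2 → ∃ b, pos σ par c m = childV (pos σ par c p) b := by
    intro m hm
    rcases hnewpos m hm with h | h
    · exact ⟨false, h⟩
    · exact ⟨true, h⟩
  have hnewdepth : ∀ m, m = 2 * j + 1 ∨ m = 2 * j + 2 → depth (pos σ par c m) = depth (pos σ par c p) + 1 := by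
    intro m hm; obtain ⟨b, hb⟩ := hchild m hm; rw [hb, depth_childV hv]
  have hnotCross : ∀ m, m = 2 * j + 1 ∨ m = 2 * j + 2 → ¬ IsCross σ par c m := by
    rintro m hm ⟨-, hd, -⟩
    rw [hq m hm] at hd
    have : depth (pos σ par c p) = n := hd
    omega
  have hnotUp : ∀ m, m = 2 * j + 1 ∨ m = 2 * j + 2 → ¬ IsUp σ par c m := by
    rintro m hm ⟨-, -, hpu⟩
    rw [hq m hm] at hpu
    obtain ⟨b, hb⟩ := hchild m hm
    have := congrArg depth (hb.symm.trans hpu)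
    rw [depth_childV hv, depth_parentV] at this
    omega
  have htd : ∀ m, m = 2 * j + 1 ∨ m = 2 * j + 2 → tdepth par m = tdepth par p + 1 := by
    rintro m (rfl | rfl)
    · exact (tdepth_child hval.2 hj).1
    · exact (tdepth_child hval.2 hj).2
  -- the landing node of a new node (down case)
  have hland : ∀ m, m = 2 * j + 1 ∨ m = 2 * j + 2 → land σ par c m = land σ par c p := by
    intro m hm
    rw [land_of_not_isCross σ par c (by rcases hm with rfl | rfl <;> omega) (hnotCross m hm)
      (by rw [hq m hm]; rcases hm with rfl | rfl <;> omega), hq m hm]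
  -- freshness
  have hfresh : ∀ m, m = 2 * j + 1 ∨ m = 2 * j + 2 → ∀ m' ≤ 2 * j, pos σ par c m ≠ pos σ par c m' := by
    intro m hm m' hm' heq
    obtain ⟨b, hb⟩ := hchild m hm
    -- the parent vertex of the common position is `(pos σ par c p)`
    have hparv : parentV (pos σ par c m') = (pos σ par c p) := by rw [← heq, hb, parentV_childV hv]
    rcases hkind with htdp | ⟨htdp, hpc, hpu⟩
    · -- `p` in the ENTRANCE tree: the new node is an A-node at a coin-only position
      have htdm : tdepth par m ≤ n := by
        obtain ⟨-, hdp, -, -⟩ := regionA σ hval.2 c p (by omega) htdp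
        have := hnewdepth m hm
        rw [htd m hm]; show tdepth par p + 1 ≤ n
        have hdv : depth (pos σ par c p) = tdepth par p := hdp
        omega
      obtain ⟨hposm, hdm, -, -⟩ := regionA σ hval.2 c m (by rcases hm with rfl | rfl <;> omega) htdm
      by_cases htdm' : tdepth par m' ≤ n
      · -- `m'` is also an A-node: then its parent node is `p`, which was not yet expanded
        obtain ⟨-, -, -, hmove'⟩ := regionA σ hval.2 c m' (by omega) htdm'
        have hm'0 : m' ≠ 0 := by
          rintro rfl
          rw [pos_zero] at heq
          have := congrArg depth heq; rw [hb, depth_childV hv, depth_entrance] at this; omega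
        obtain ⟨hdq', hmv'⟩ := hmove' hm'0
        have hpq : pos σ par c (parentOf par m') = (pos σ par c p) := by rw [← hparv, hmv', parentV_childV hdq']
        have hqm : parentOf par m' = p := I.inj _ (by
          obtain ⟨-, hlt⟩ := parentOf_lt hval.2 (Nat.one_le_iff_ne_zero.mpr hm'0) (by omega); omega) p hp_le hpq
        obtain ⟨hpeq, -⟩ := parentOf_lt hval.2 (Nat.one_le_iff_ne_zero.mpr hm'0) (by omega : m' ≤ 2 * par.length)
        apply hunexp
        refine ⟨(m' - 1) / 2, by omega, ?_⟩
        rw [List.getElem?_eq_getElem (by omega), ← hpeq, hqm]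
      · -- `m'` outside the ENTRANCE tree: its landing block would meet the coin-only tree
        obtain ⟨hdeep', hcl, hlm, -, -, hblk⟩ := I.nonA m' hm' (by omega)
        have hdeep : n + 1 - h ≤ depth (aPos (n := n) par c m) := by rw [← hposm, heq]; exact hdeep'
        have := I.landA (land σ par c m') (by omega) hcl m (by rcases hm with rfl | rfl <;> omega) htdm hdeep
        apply this
        rw [← hblk, ← heq, hposm]
    · -- `p` is a down node outside the ENTRANCE tree
      obtain ⟨hdeepp, hclp, hlp, htdlp, hexpp, hblkp⟩ := I.nonA p hp_le htdp
      obtain ⟨-, -, -, -, -, r, hr1, hrh, hdesc⟩ := I.down p hp_le htdp hpc hpu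
      set L := land σ par c p with hL
      set ℓ := pos σ par c L with hℓ
      have hℓn : depth ℓ = n := hclp.2.2
      have hdescm : IsDesc (sib ℓ r) (pos σ par c m) := by rw [hb]; exact isDesc_childV hdesc hv b
      have hblkm : blk h (pos σ par c m) = blk h ℓ := by rw [hb, blk_childV hdeepp hv, hblkp]
      by_cases htdm' : tdepth par m' ≤ n
      · -- `m'` in the ENTRANCE tree: the landing block of `p` would meet the coin-only tree
        obtain ⟨hposm', -, -, -⟩ := regionA σ hval.2 c m' (by omega) htdm'
        have hdeep : n + 1 - h ≤ depth (aPos (n := n) par c m') := by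
          rw [← hposm', ← heq, hb, depth_childV hv]; omega
        apply I.landA L (by omega) hclp m' (by omega) htdm' hdeep
        rw [← hℓ, ← hblkm, heq, hposm']
      · -- `m'` outside: same block, hence same landing node, and the branch structure decides
        obtain ⟨-, hcl', hlm', -, -, hblk'⟩ := I.nonA m' hm' (by omega)
        have hLL : land σ par c m' = L := by
          by_contra hne'
          exact I.landBlk _ (by omega) L (by omega) hcl' hclp hne' (by rw [← hblk', ← heq, hblkm])
        by_cases hc' : IsCross σ par c m'
        · -- `m'` is the landing node itself: `ℓ` is not in a side branch
          have : m' = L := by rw [← land_of_isCross σ par c hc', hLL]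
          rw [this, ← hℓ] at heq
          have h0 := not_isDesc_sib_anc hr1 (by omega) (by omega) 0 (ℓ := ℓ)
          rw [anc_zero] at h0
          exact h0 (heq ▸ hdescm)
        · by_cases hu' : IsUp σ par c m'
          · obtain ⟨-, hposu, -⟩ := I.up m' hm' hu'
            rw [hLL, ← hℓ] at hposu
            have h0 := not_isDesc_sib_anc hr1 (by omega) (by omega) (upCount σ par c m') (ℓ := ℓ)
            rw [← hposu, ← heq] at h0
            exact h0 hdescm
          · obtain ⟨hdq', hpar', -, -, -, r', hr'1, hr'h, hdesc'⟩ := I.down m' hm' (by omega) hc' hu'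
            rw [hLL, ← hℓ] at hdesc'
            have hrr : r' = r :=
              sib_branch_disjoint hr'1 hr1 (by omega) (by omega) (by omega) hdesc' (heq ▸ hdescm)
            -- the parent node of `m'` sits at `(pos σ par c p)`: it is `p`, not yet expanded
            have hpq : pos σ par c (parentOf par m') = (pos σ par c p) := by rw [← hpar', ← hparv]
            have hm'1 : 1 ≤ m' := by
              rcases Nat.eq_zero_or_pos m' with rfl | h
              · exact absurd (tdepth_zero par ▸ (show n < tdepth par 0 by omega)) (by simp)
              · exact h
            obtain ⟨hpeq, hlt⟩ := parentOf_lt hval.2 hm'1 (by omega : m' ≤ 2 * par.length)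
            have hqm : parentOf par m' = p := I.inj _ (by omega) p hp_le hpq
            apply hunexp
            refine ⟨(m' - 1) / 2, by omega, ?_⟩
            rw [List.getElem?_eq_getElem (by omega), ← hpeq, hqm]
  -- assemble
  obtain ⟨hreadIff, hreadOcc, hseg⟩ := step_reads_of_depth_lt σ hval c hj I hv hnotCross hfresh
  refine geomInv_succ_of I ?_ hfresh ?_ ?_ ?_ ?_ ?_ ?_ ?_ hreadIff hreadOcc hseg
  · intro m hm
    rw [hq m hm]
    rcases hnewpos m hm with h' | h' <;> rw [h']
    exacts [hmem0, hmem1]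
  · rcases hor with ⟨h0, h1⟩ | ⟨h0, h1⟩ <;> rw [h0, h1]
    exacts [hne, hne.symm]
  · intro m hm htdm
    rcases hkind with htdp | ⟨htdp, hpc, hpu⟩
    · exfalso
      obtain ⟨-, hdp, -, -⟩ := regionA σ hval.2 c p (by omega) htdp
      have hdv : depth (pos σ par c p) = tdepth par p := hdp
      rw [htd m hm] at htdm; omega
    · obtain ⟨hdeepp, hclp, hlp, htdlp, hexpp, hblkp⟩ := I.nonA p hp_le htdp
      obtain ⟨b, hb⟩ := hchild m hm
      rw [hland m hm]
      refine ⟨by rw [hb, depth_childV hv]; omega, hclp, by rcases hm with rfl | rfl <;> omega, htdlp, fun _ ↦ ?_, ?_⟩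
      · by_cases hlpp : land σ par c p = p
        · refine ⟨j, by rcases hm with rfl | rfl <;> omega, ?_⟩
          rw [hlpp, List.getElem?_eq_getElem hj]
        · obtain ⟨i, hi, hpi⟩ := hexpp hlpp
          exact ⟨i, by rcases hm with rfl | rfl <;> omega, hpi⟩
      · rw [hb, blk_childV hdeepp hv, hblkp]
  · intro m hm hc; exact absurd hc (hnotCross m hm)
  · intro hc; exact absurd hc (hnotCross _ (Or.inl rfl))
  · intro m hm hc; exact absurd hc (hnotCross m hm)
  · intro m hm hu'; exact absurd hu' (hnotUp m hm)
  · intro m hm htdm hc hu'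
    rcases hkind with htdp | ⟨htdp, hpc, hpu⟩
    · exfalso
      obtain ⟨-, hdp, -, -⟩ := regionA σ hval.2 c p (by omega) htdp
      have hdv : depth (pos σ par c p) = tdepth par p := hdp
      rw [htd m hm] at htdm; omega
    · obtain ⟨hdeepp, -, -, -, -, -⟩ := I.nonA p hp_le htdp
      obtain ⟨-, -, -, -, -, r, hr1, hrh, hdesc⟩ := I.down p hp_le htdp hpc hpu
      obtain ⟨b, hb⟩ := hchild m hm
      rw [hq m hm, hland m hm]
      refine ⟨hv, by rw [hb, parentV_childV hv], by rw [hb, depth_childV hv], htdp, hpc, r, hr1, hrh, ?_⟩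
      rw [hb]; exact isDesc_childV hdesc hv b

/-! ### Up expansions -/

include hn hh hval hj I hdeep in
/-- **Induction step for the expansion of an up node** `p` at `anc ℓ u` (`ℓ` its landing
leaf, `u` its up-count): one child climbs to `anc ℓ (u+1)` (part (i): `u + 1 < h`), the other
starts the side branch `sib ℓ u`; both positions are fresh and the invariant is preserved.
[cite: ChildsEtAl2003, §4 (Lemma 8)] -/
theorem step_up (hpu : IsUp σ par c par[j]) : GeomInv σ par c t h (j + 1) := by
  obtain ⟨hp_le, hunexp, hpj, hq1, hq2⟩ := step_node hval hj
  set p := par[j] with hp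
  have hE : 2 * j + 2 ≤ 2 * par.length := by omega
  have hp0 : p ≠ 0 := hpu.1
  -- data of the up node `p`
  obtain ⟨htdp, hposp, hparp⟩ := I.up p hp_le hpu
  obtain ⟨hdeepp, hclp, hlp, htdlp, hexpp, hblkp⟩ := I.nonA p hp_le htdp
  have hpc : ¬ IsCross σ par c p := fun hc ↦ not_isUp_of_isCross hc hpu
  set L := land σ par c p with hL
  set ℓ := pos σ par c L with hℓ
  set u := upCount σ par c p with hu
  have hℓn : depth ℓ = n := hclp.2.2
  have hu1 : 1 ≤ u := by rw [hu, upCount_eq_succ σ hval.2 c (by omega) hpu]; omega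
  have huh : u < h := by
    by_contra hge
    exact hdeep ⟨p, by omega, not_lt.mp hge⟩
  have hdp : depth (pos σ par c p) = n - u := by rw [hposp, depth_anc, hℓn]
  have hdp1 : 1 ≤ depth (pos σ par c p) := by omega
  have hdpn : depth (pos σ par c p) < n := by omega
  -- the entering vertex is the child `anc ℓ (u-1)` of `anc ℓ u`
  have hqpos : pos σ par c (parentOf par p) = anc ℓ (u - 1) := by
    rcases hparp with hqu | hqL
    · obtain ⟨-, hposq, -⟩ := I.up (parentOf par p) (by obtain ⟨-, h⟩ := parentOf_lt hval.2 (by omega) (show p ≤ 2 * par.length by omega); omega) hqu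
      have hlq : land σ par c (parentOf par p) = L := by
        rw [hL, land_of_not_isCross σ par c hp0 hpc (by obtain ⟨-, h⟩ := parentOf_lt hval.2 (by omega) (show p ≤ 2 * par.length by omega); omega)]
      rw [hposq, hlq, ← hℓ]
      congr 1
      rw [hu, upCount_eq_succ σ hval.2 c (by omega) hpu]; omega
    · have hu1' : u = 1 := by
        rw [hu, upCount_eq_succ σ hval.2 c (by omega) hpu, hqL,
          upCount_eq_zero σ hval.2 c (by omega) (not_isUp_of_isCross hclp)]
      rw [hqL, ← hℓ, hu1']; rfl
  obtain ⟨hsibpar, hsibd, hsibne, hsibch⟩ := sib_spec (ℓ := ℓ) hu1 (by omega) (by omega)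
  -- which child of `anc ℓ u` is `anc ℓ (u-1)`
  have hancu : anc ℓ u = pos σ par c p := hposp.symm
  obtain ⟨b₀, hb₀, hsib⟩ : ∃ b₀, anc ℓ (u - 1) = childV (pos σ par c p) b₀ ∧ sib ℓ u = childV (pos σ par c p) (!b₀) := by
    have hch : IsChild (anc ℓ (u - 1)) (pos σ par c p) := by
      rw [isChild_iff_eq_parentV]
      refine ⟨by rw [depth_anc, hℓn]; omega, ?_⟩
      rw [← hancu, ← anc_succ, show u - 1 + 1 = u by omega]
    obtain ⟨-, h01⟩ := isChild_iff_eq_childV.mp hch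
    rw [hancu] at hsibch
    rcases h01 with h0 | h1
    · refine ⟨false, h0, ?_⟩
      rcases hsibch with hs | hs
      · exact absurd (hs.trans h0.symm) hsibne
      · exact hs
    · refine ⟨true, h1, ?_⟩
      rcases hsibch with hs | hs
      · exact hs
      · exact absurd (hs.trans h1.symm) hsibne
  -- the options
  have hos : stepOpts σ (pos σ par c p) (if p = 0 then none else some (pos σ par c (parentOf par p))) =
      [anc ℓ (u + 1), sib ℓ u] := by
    rw [if_neg hp0, hqpos, hb₀, stepOpts_childV hdpn (by omega), hsib, ← hancu, ← anc_succ]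
  obtain ⟨hne, hnewpos, hor, hmem0, hmem1⟩ := step_children_of_eq hn σ hval c hh hj I hos
  have hq : ∀ m, m = 2 * j + 1 ∨ m = 2 * j + 2 → parentOf par m = p := by
    rintro m (rfl | rfl); exacts [hq1, hq2]
  have htd : ∀ m, m = 2 * j + 1 ∨ m = 2 * j + 2 → tdepth par m = tdepth par p + 1 := by
    rintro m (rfl | rfl)
    · exact (tdepth_child hval.2 hj).1
    · exact (tdepth_child hval.2 hj).2
  have hnotCross : ∀ m, m = 2 * j + 1 ∨ m = 2 * j + 2 → ¬ IsCross σ par c m := by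
    rintro m hm ⟨-, hd, -⟩
    rw [hq m hm] at hd
    omega
  -- the up child has up-count `u + 1 < h`
  have hupchild : ∀ m, m = 2 * j + 1 ∨ m = 2 * j + 2 → pos σ par c m = anc ℓ (u + 1) →
      IsUp σ par c m ∧ upCount σ par c m = u + 1 := by
    intro m hm hpm
    have hum : IsUp σ par c m := by
      refine ⟨by rcases hm with rfl | rfl <;> omega, by rw [hq m hm]; exact hdp1, ?_⟩
      rw [hq m hm, hpm, ← hancu, ← anc_succ]
    refine ⟨hum, ?_⟩
    rw [upCount_eq_succ σ hval.2 c (by rcases hm with rfl | rfl <;> omega) hum, hq m hm]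
  have hu2 : u + 1 < h := by
    -- one of the two new nodes is the up child
    rcases hor with ⟨h0, -⟩ | ⟨-, h0⟩
    · obtain ⟨-, hcnt⟩ := hupchild _ (Or.inl rfl) h0
      by_contra hge
      exact hdeep ⟨2 * j + 1, by omega, by rw [hcnt]; omega⟩
    · obtain ⟨-, hcnt⟩ := hupchild _ (Or.inr rfl) h0
      by_contra hge
      exact hdeep ⟨2 * j + 2, by omega, by rw [hcnt]; omega⟩
  have hnotUp_sib : ∀ m, m = 2 * j + 1 ∨ m = 2 * j + 2 → pos σ par c m = sib ℓ u → ¬ IsUp σ par c m := by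
    rintro m hm hpm ⟨-, -, hup'⟩
    rw [hq m hm, hpm, hsib] at hup'
    have := congrArg depth hup'
    rw [depth_childV hdpn, depth_parentV] at this
    omega
  -- landing node of the new nodes
  have hland : ∀ m, m = 2 * j + 1 ∨ m = 2 * j + 2 → land σ par c m = L := by
    intro m hm
    rw [land_of_not_isCross σ par c (by rcases hm with rfl | rfl <;> omega) (hnotCross m hm)
      (by rw [hq m hm]; rcases hm with rfl | rfl <;> omega), hq m hm]
  -- depths and blocks of the new positions
  have hdeep_up : n + 1 - h ≤ depth (anc ℓ (u + 1)) := by rw [depth_anc, hℓn]; omega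
  have hdeep_sib : n + 1 - h ≤ depth (sib ℓ u) := by rw [hsibd, hℓn]; omega
  have hblk_up : blk h (anc ℓ (u + 1)) = blk h ℓ := blk_anc (by rw [hℓn]; omega)
  have hblk_sib : blk h (sib ℓ u) = blk h ℓ := by
    rw [hsib, blk_childV (by omega) hdpn, ← hancu, blk_anc (by rw [hℓn]; omega)]
  have hblkp' : blk h (pos σ par c p) = blk h ℓ := hblkp
  -- freshness
  have hfresh : ∀ m, m = 2 * j + 1 ∨ m = 2 * j + 2 → ∀ m' ≤ 2 * j, pos σ par c m ≠ pos σ par c m' := by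
    intro m hm m' hm' heq
    have hdeepm : n + 1 - h ≤ depth (pos σ par c m) := by
      rcases hnewpos m hm with h' | h' <;> rw [h']; exacts [hdeep_up, hdeep_sib]
    have hblkm : blk h (pos σ par c m) = blk h ℓ := by
      rcases hnewpos m hm with h' | h' <;> rw [h']; exacts [hblk_up, hblk_sib]
    by_cases htdm' : tdepth par m' ≤ n
    · -- `m'` in the ENTRANCE tree: landing block of `L` would meet the coin-only tree
      obtain ⟨hposm', -, -, -⟩ := regionA σ hval.2 c m' (by omega) htdm'
      have hdeep' : n + 1 - h ≤ depth (aPos (n := n) par c m') := by rw [← hposm', ← heq]; exact hdeepm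
      apply I.landA L (by omega) hclp m' (by omega) htdm' hdeep'
      rw [← hℓ, ← hblkm, heq, hposm']
    · obtain ⟨-, hcl', hlm', -, -, hblk'⟩ := I.nonA m' hm' (by omega)
      have hLL : land σ par c m' = L := by
        by_contra hne'
        exact I.landBlk _ (by omega) L (by omega) hcl' hclp hne' (by rw [← hblk', ← heq, hblkm])
      by_cases hc' : IsCross σ par c m'
      · -- `m' = L` sits at the leaf `ℓ`, deeper than both new positions
        have hm'L : m' = L := by rw [← land_of_isCross σ par c hc', hLL]
        have hdm' : depth (pos σ par c m') = n := hc'.2.2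
        have hn' := hn
        rcases hnewpos m hm with h' | h'
        · have hde : depth (pos σ par c m') = depth (anc ℓ (u + 1)) := by rw [← heq, h']
          rw [hdm', depth_anc, hℓn] at hde
          omega
        · have h0 := not_isDesc_sib_anc hu1 (by rw [hℓn]; omega) (by rw [hℓn]) 0 (ℓ := ℓ)
          rw [anc_zero] at h0
          apply h0
          have hpm' : pos σ par c m' = ℓ := by rw [hm'L]
          have hsl : sib ℓ u = ℓ := by rw [← h', heq, hpm']
          exact (congrArg (IsDesc (sib ℓ u)) hsl).mp (isDesc_refl _)
      · by_cases hu' : IsUp σ par c m'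
        · obtain ⟨-, hposu, hparu⟩ := I.up m' hm' hu'
          rw [hLL, ← hℓ] at hposu
          rcases hnewpos m hm with h' | h'
          · -- an old up node at `anc ℓ (u+1)`: its parent would be `p`
            rw [h'] at heq
            have hcm' : upCount σ par c m' < h := by
              by_contra hge; exact hdeep ⟨m', by omega, not_lt.mp hge⟩
            have hcnt : upCount σ par c m' = u + 1 := by
              apply anc_injective_of_le (v := ℓ) (by rw [hℓn]; omega) (by rw [hℓn]; omega)
              rw [← hposu, ← heq]
            have hm'1 : 1 ≤ m' := Nat.one_le_iff_ne_zero.mpr hu'.1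
            obtain ⟨hpeq, hlt⟩ := parentOf_lt hval.2 hm'1 (by omega : m' ≤ 2 * par.length)
            have hcntq : upCount σ par c (parentOf par m') = u := by
              have := upCount_eq_succ σ hval.2 c (by omega) hu'; omega
            -- the parent of `m'` is an up node at `anc ℓ u = pos p`
            have hqpos' : pos σ par c (parentOf par m') = pos σ par c p := by
              rcases hparu with hqu | hqL
              · obtain ⟨-, hposq, -⟩ := I.up (parentOf par m') (by omega) hqu
                have hlq : land σ par c (parentOf par m') = L := by
                  rw [← hLL, land_of_not_isCross σ par c hu'.1 hc' (by omega)]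
                rw [hposq, hlq, ← hℓ, hcntq, hancu]
              · exfalso
                rw [hqL, hLL, upCount_eq_zero σ hval.2 c (by omega) (not_isUp_of_isCross hclp)] at hcntq
                omega
            have hqm : parentOf par m' = p := I.inj _ (by omega) p hp_le hqpos'
            apply hunexp
            refine ⟨(m' - 1) / 2, by omega, ?_⟩
            rw [List.getElem?_eq_getElem (by omega), ← hpeq, hqm]
          · -- an old up node at `sib ℓ u`: impossible, up nodes are ancestors of `ℓ`
            have h0 := not_isDesc_sib_anc hu1 (by rw [hℓn]; omega) (by rw [hℓn]) (upCount σ par c m') (ℓ := ℓ)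
            rw [← hposu, ← heq, h'] at h0
            exact h0 (isDesc_refl _)
        · obtain ⟨hdq', hpar', -, -, -, r', hr'1, hr'h, hdesc'⟩ := I.down m' hm' (by omega) hc' hu'
          rw [hLL, ← hℓ] at hdesc'
          rcases hnewpos m hm with h' | h'
          · -- an old down node at `anc ℓ (u+1)`: impossible, side branches avoid ancestors
            have h0 := not_isDesc_sib_anc hr'1 (by rw [hℓn]; omega) (by rw [hℓn]) (u + 1) (ℓ := ℓ)
            rw [← h', heq] at h0
            exact h0 hdesc'
          · -- an old down node at `sib ℓ u`: it is the root of branch `u`, its parent is `p`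
            rw [h'] at heq
            have hrr : r' = u :=
              sib_branch_disjoint hr'1 hu1 (by rw [hℓn]; omega) (by rw [hℓn]; omega) (by rw [hℓn]) hdesc'
                (heq ▸ isDesc_refl _)
            have hqpos' : pos σ par c (parentOf par m') = pos σ par c p := by
              rw [← hpar', ← heq, hsibpar, hancu]
            have hm'1 : 1 ≤ m' := by
              rcases Nat.eq_zero_or_pos m' with rfl | h
              · exact absurd (show n < tdepth par 0 by omega) (by simp)
              · exact h
            obtain ⟨hpeq, hlt⟩ := parentOf_lt hval.2 hm'1 (by omega : m' ≤ 2 * par.length)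
            have hqm : parentOf par m' = p := I.inj _ (by omega) p hp_le hqpos'
            apply hunexp
            refine ⟨(m' - 1) / 2, by omega, ?_⟩
            rw [List.getElem?_eq_getElem (by omega), ← hpeq, hqm]
  -- assemble
  obtain ⟨hreadIff, hreadOcc, hseg⟩ := step_reads_of_depth_lt σ hval c hj I hdpn hnotCross hfresh
  refine geomInv_succ_of I ?_ hfresh ?_ ?_ ?_ ?_ ?_ ?_ ?_ hreadIff hreadOcc hseg
  · intro m hm
    rw [hq m hm]
    rcases hnewpos m hm with h' | h' <;> rw [h']
    exacts [hmem0, hmem1]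
  · rcases hor with ⟨h0, h1⟩ | ⟨h0, h1⟩ <;> rw [h0, h1]
    exacts [hne, hne.symm]
  · intro m hm _
    rw [hland m hm]
    refine ⟨?_, hclp, by rcases hm with rfl | rfl <;> omega, htdlp, fun _ ↦ ?_, ?_⟩
    · rcases hnewpos m hm with h' | h' <;> rw [h']; exacts [hdeep_up, hdeep_sib]
    · by_cases hlpp : L = p
      · refine ⟨j, by rcases hm with rfl | rfl <;> omega, ?_⟩
        rw [hlpp, List.getElem?_eq_getElem hj]
      · obtain ⟨i, hi, hpi⟩ := hexpp hlpp
        exact ⟨i, by rcases hm with rfl | rfl <;> omega, hpi⟩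
    · rw [← hℓ]
      rcases hnewpos m hm with h' | h' <;> rw [h']; exacts [hblk_up, hblk_sib]
  · intro m hm hc; exact absurd hc (hnotCross m hm)
  · intro hc; exact absurd hc (hnotCross _ (Or.inl rfl))
  · intro m hm hc; exact absurd hc (hnotCross m hm)
  · intro m hm hum
    refine ⟨by rw [htd m hm]; omega, ?_, Or.inl (by rw [hq m hm]; exact hpu)⟩
    rw [hland m hm, ← hℓ]
    rcases hnewpos m hm with h' | h'
    · obtain ⟨-, hcnt⟩ := hupchild m hm h'
      rw [h', hcnt]
    · exact absurd hum (hnotUp_sib m hm h')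
  · intro m hm _ _ hum
    rcases hnewpos m hm with h' | h'
    · exact absurd (hupchild m hm h').1 hum
    · rw [hq m hm, hland m hm, ← hℓ, h']
      refine ⟨hdpn, by rw [hsibpar, hancu], by rw [hsibd, hdp, hℓn]; omega, htdp, hpc, u, hu1, by omega, isDesc_refl _⟩

end Step

end GluedTrees

end Literature.Computability.QuantumComplexity

/-!
# Glued trees, Theorem 9 (classical lower bound) — XV: geometry of the embedding, crossing the cycle

Theorem-only support file for `ChildsEtAl2003_thm9` (rigorous Lemma 8, geometric half): the
induction step of `GeomInv` for the expansions that read the random cycle —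

* `step_creation`: a node at a leaf entered from its parent (a node of the ENTRANCE tree at
  depth `n`, or a down node of an excursion reaching a leaf); its two children cross the cycle
  to the leaves in the two neighbouring slots, which are read for the first time (a new
  "segment" of read slots is created). Absence of `BadSpread` puts the new segment far from the
  old ones; absence of `BadBlock` makes the two landing blocks new.

The common unfoldings of the two events are `not_badSpread_imp`, `not_badBlock_imp`.

## References

* [ChildsEtAl2003] A. M. Childs et al., Exponential algorithmic speedup by a quantum walk,
  STOC 2003, §4, Lemma 8 (ii).
-/

open Literature.Computability.Complexity

namespace Literature.Computability.QuantumComplexity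

namespace GluedTrees

open Finset

variable {n : ℕ}

/-! ### Touched blocks and the events, unfolded -/

/-- The block of a deep position of an existing node is touched. [cite: ChildsEtAl2003, §4 (Lemma 8 (ii))] -/
theorem blk_pos_mem_occBlocks (σ : CycleDatum n) (par : List ℕ) (c : ℕ → Bool) (h : ℕ) {j m : ℕ} (hm : m ≤ 2 * j)
    (hdeep : n + 1 - h ≤ depth (pos σ par c m)) : blk h (pos σ par c m) ∈ occBlocks σ par c h j := by
  unfold occBlocks
  apply Finset.mem_union_left
  rw [Finset.mem_image]
  exact ⟨m, Finset.mem_filter.mpr ⟨Finset.mem_range.mpr (by omega), hdeep⟩, rfl⟩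

/-- The block of a deep coin-only position of a node of the ENTRANCE tree is touched.
[cite: ChildsEtAl2003, §4 (Lemma 8 (ii))] -/
theorem blk_aPos_mem_occBlocks (σ : CycleDatum n) (par : List ℕ) (c : ℕ → Bool) (h j : ℕ) {a : ℕ}
    (ha : a ≤ 2 * par.length) (htd : tdepth par a ≤ n) (hdeep : n + 1 - h ≤ depth (aPos (n := n) par c a)) :
    blk h (aPos (n := n) par c a) ∈ occBlocks σ par c h j := by
  unfold occBlocks
  apply Finset.mem_union_right
  rw [Finset.mem_image]
  exact ⟨a, Finset.mem_filter.mpr ⟨Finset.mem_range.mpr (by omega), htd, hdeep⟩, rfl⟩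

/-- **No spread at step `j`, unfolded**: if the expanded node sits at a leaf whose slot `x` is
unread, every read slot is farther than `2t + 4` from `x`. [cite: ChildsEtAl2003, §4 (Lemma 8 (ii))] -/
theorem not_badSpread_imp {σ : CycleDatum n} {par : List ℕ} {c : ℕ → Bool} {t j : ℕ} (h : ¬ BadSpread σ par c t j)
    (hd : depth (pos σ par c (par.getD j 0)) = n)
    (hx : slotOf σ (pos σ par c (par.getD j 0)) ∉ revSlots σ par c j) :
    ∀ y ∈ revSlots σ par c j, ∀ d : ℤ, |d| ≤ 2 * t + 4 → y ≠ slotOf σ (pos σ par c (par.getD j 0)) + d := by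
  intro y hy d hd' heq
  exact h ⟨hd, hx, y, hy, d, hd', heq⟩

/-- **No block event at step `j`, unfolded**: if the expanded node sits at a leaf with slot `x`,
then a neighbouring slot `x ± 1` that is unread holds a leaf whose block is untouched, and if both
are unread their blocks differ. [cite: ChildsEtAl2003, §4 (Lemma 8 (ii))] -/
theorem not_badBlock_imp {σ : CycleDatum n} {par : List ℕ} {c : ℕ → Bool} {h j : ℕ} (hb : ¬ BadBlock σ par c h j)
    (hd : depth (pos σ par c (par.getD j 0)) = n) :
    (∀ y, (y = slotOf σ (pos σ par c (par.getD j 0)) + 1 ∨ y = slotOf σ (pos σ par c (par.getD j 0)) - 1) →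
      y ∉ revSlots σ par c j → blk h (slotVal σ y) ∉ occBlocks σ par c h j) ∧
    (slotOf σ (pos σ par c (par.getD j 0)) + 1 ∉ revSlots σ par c j →
      slotOf σ (pos σ par c (par.getD j 0)) - 1 ∉ revSlots σ par c j →
      blk h (slotVal σ (slotOf σ (pos σ par c (par.getD j 0)) + 1)) ≠
        blk h (slotVal σ (slotOf σ (pos σ par c (par.getD j 0)) - 1))) := by
  constructor
  · intro y hy hny hblk
    apply hb
    refine ⟨hd, Or.inl ⟨y, ?_, hblk⟩⟩
    rw [Finset.mem_sdiff, Finset.mem_insert, Finset.mem_singleton]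
    exact ⟨hy, hny⟩
  · intro h1 h2 heq
    exact hb ⟨hd, Or.inr ⟨h1, h2, heq⟩⟩

/-- Entering a leaf along the cycle from the slot next to it, the onward options are its parent and
the leaf in the slot on the other side. [cite: ChildsEtAl2003, §4 (Game 5)] -/
theorem stepOpts_slotVal_adj (hn : 1 ≤ n) (σ : CycleDatum n) {v : Vertex n} (hv : depth v = n) {s s' : Slot n}
    (hs : (s = slotOf σ v + 1 ∧ s' = slotOf σ v - 1) ∨ (s = slotOf σ v - 1 ∧ s' = slotOf σ v + 1)) :
    stepOpts σ v (some (slotVal σ s)) = [parentV v, slotVal σ s'] := by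
  obtain ⟨i, rfl | rfl⟩ := exists_eq_leaf hv
  · obtain ⟨h1, h2⟩ := cross_eq_slotVal_left hn σ i
    rcases hs with ⟨rfl, rfl⟩ | ⟨rfl, rfl⟩
    · rw [← h1, stepOpts_cross₁ hv, h2]
    · rw [← h2, stepOpts_cross₂ hn hv, h1]
  · obtain ⟨h1, h2⟩ := cross_eq_slotVal_right σ i
    rcases hs with ⟨rfl, rfl⟩ | ⟨rfl, rfl⟩
    · rw [← h2, stepOpts_cross₂ hn hv, h1]
    · rw [← h1, stepOpts_cross₁ hv, h2]

section Step

variable (hn : 1 ≤ n) (σ : CycleDatum n) {par : List ℕ} (hval : ValidPar par) (c : ℕ → Bool) {t h : ℕ}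
  (ht : par.length ≤ t) (hN : 4 * t + 10 ≤ 2 ^ n) (h1 : 1 ≤ h) (hh : h ≤ n) {j : ℕ} (hj : j < par.length)
  (I : GeomInv σ par c t h j)
  (hspread : ¬ BadSpread σ par c t j) (hblock : ¬ BadBlock σ par c h j)

/-! ### Creation of a segment -/

include hn hval hN h1 hh hj I hspread hblock in
/-- **Induction step for a first crossing** (a node at a leaf entered from its parent: its two
children cross the cycle into the two neighbouring slots, read for the first time).
[cite: ChildsEtAl2003, §4 (Lemma 8 (ii))] -/
theorem step_creation (hv : depth (pos σ par c par[j]) = n)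
    (hu : pos σ par c (parentOf par par[j]) = parentV (pos σ par c par[j])) (hp0 : par[j] ≠ 0)
    (hkind : tdepth par par[j] ≤ n ∨
      (n < tdepth par par[j] ∧ ¬ IsCross σ par c par[j] ∧ ¬ IsUp σ par c par[j])) :
    GeomInv σ par c t h (j + 1) := by
  obtain ⟨hp_le, hunexp, hpj, hq1, hq2⟩ := step_node hval hj
  set p := par[j] with hp
  have hE : 2 * j + 2 ≤ 2 * par.length := by omega
  have hK : 2 * (2 * t + 4) < 2 ^ (n + 1) := by rw [Nat.pow_succ']; omega
  -- the slot of the leaf is unread, hence far from everything read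
  have hpc : ¬ IsCross σ par c p := by
    rcases hkind with htd | ⟨-, hc, -⟩
    · exact not_isCross_of_tdepth_le σ hval.2 c (by omega) htd
    · exact hc
  have hx : slotOf σ (pos σ par c p) ∉ revSlots σ par c j := by
    rw [I.readIff p hp_le hv]
    rintro (hc | he)
    · exact hpc hc
    · exact hunexp he
  have hfar := not_badSpread_imp hspread (by rw [hpj]; exact hv) (by rw [hpj]; exact hx)
  rw [hpj] at hfar
  have hx1 : slotOf σ (pos σ par c p) + 1 ∉ revSlots σ par c j := by
    intro hmem
    exact hfar _ hmem 1 (by simp; omega) (by push_cast; try ring)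
  have hx2 : slotOf σ (pos σ par c p) - 1 ∉ revSlots σ par c j := by
    intro hmem
    exact hfar _ hmem (-1) (by simp; omega) (by push_cast; try ring)
  obtain ⟨hbocc, hbne⟩ := not_badBlock_imp hblock (by rw [hpj]; exact hv)
  rw [hpj] at hbocc hbne
  have hbne' := hbne hx1 hx2
  -- the options: the two cross neighbours
  have hos : stepOpts σ (pos σ par c p) (if p = 0 then none else some (pos σ par c (parentOf par p))) =
      [cross₁ σ (pos σ par c p), cross₂ σ (pos σ par c p)] := by
    rw [if_neg hp0, hu]; exact stepOpts_parentV_of_depth_eq hv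
  obtain ⟨hne, hnewpos, hor, hmem0, hmem1⟩ := step_children_of_eq hn σ hval c hh hj I hos
  have hcrossset := cross_pair_eq_slotVal hn σ hv
  have hnewslot : ∀ m, m = 2 * j + 1 ∨ m = 2 * j + 2 →
      pos σ par c m = slotVal σ (slotOf σ (pos σ par c p) + 1) ∨ pos σ par c m = slotVal σ (slotOf σ (pos σ par c p) - 1) := by
    intro m hm
    have : pos σ par c m ∈ ({cross₁ σ (pos σ par c p), cross₂ σ (pos σ par c p)} : Finset (Vertex n)) := by
      rcases hnewpos m hm with h' | h' <;> simp [h']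
    rw [hcrossset, Finset.mem_insert, Finset.mem_singleton] at this
    exact this
  have hq : ∀ m, m = 2 * j + 1 ∨ m = 2 * j + 2 → parentOf par m = p := by
    rintro m (rfl | rfl); exacts [hq1, hq2]
  have htd : ∀ m, m = 2 * j + 1 ∨ m = 2 * j + 2 → tdepth par m = tdepth par p + 1 := by
    rintro m (rfl | rfl)
    · exact (tdepth_child hval.2 hj).1
    · exact (tdepth_child hval.2 hj).2
  have hnewd : ∀ m, m = 2 * j + 1 ∨ m = 2 * j + 2 → depth (pos σ par c m) = n := by
    intro m hm; rcases hnewslot m hm with h' | h' <;> rw [h', depth_slotVal]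
  have hcross : ∀ m, m = 2 * j + 1 ∨ m = 2 * j + 2 → IsCross σ par c m := by
    intro m hm
    exact ⟨by rcases hm with rfl | rfl <;> omega, by rw [hq m hm]; exact hv, hnewd m hm⟩
  have hblknew : ∀ m, m = 2 * j + 1 ∨ m = 2 * j + 2 → blk h (pos σ par c m) ∉ occBlocks σ par c h j := by
    intro m hm
    rcases hnewslot m hm with h' | h' <;> rw [h']
    · exact hbocc _ (Or.inl rfl) hx1
    · exact hbocc _ (Or.inr rfl) hx2
  have htdnew : ∀ m, m = 2 * j + 1 ∨ m = 2 * j + 2 → n < tdepth par m := by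
    intro m hm
    rw [htd m hm]
    rcases hkind with htdp | ⟨htdp, -, -⟩
    · obtain ⟨-, hdp, -, -⟩ := regionA σ hval.2 c p (by omega) htdp
      have : depth (pos σ par c p) = tdepth par p := hdp
      omega
    · omega
  -- freshness
  have hfresh : ∀ m, m = 2 * j + 1 ∨ m = 2 * j + 2 → ∀ m' ≤ 2 * j, pos σ par c m ≠ pos σ par c m' := by
    intro m hm m' hm' heq
    apply hblknew m hm
    rw [heq]
    exact blk_pos_mem_occBlocks σ par c h hm' (by rw [← heq, hnewd m hm]; omega)
  have hdist : pos σ par c (2 * j + 1) ≠ pos σ par c (2 * j + 2) := by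
    rcases hor with ⟨h0, h1'⟩ | ⟨h0, h1'⟩ <;> rw [h0, h1']; exacts [hne, hne.symm]
  -- the new read set
  have hrev : revSlots σ par c (j + 1) = revSlots σ par c j ∪
      {slotOf σ (pos σ par c p), slotOf σ (pos σ par c p) + 1, slotOf σ (pos σ par c p) - 1} := by
    rw [revSlots_succ, hpj, if_pos hv]
  -- no old node sits in a newly read slot other than `p` at `x`
  have hnoold : ∀ m' ≤ 2 * j, depth (pos σ par c m') = n →
      slotOf σ (pos σ par c m') ≠ slotOf σ (pos σ par c p) + 1 ∧ slotOf σ (pos σ par c m') ≠ slotOf σ (pos σ par c p) - 1 := by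
    intro m' hm' hd'
    constructor
    · intro heq
      have hpos : pos σ par c m' = slotVal σ (slotOf σ (pos σ par c p) + 1) := by rw [← heq, slotVal_slotOf σ hd']
      have : blk h (slotVal σ (slotOf σ (pos σ par c p) + 1)) ∈ occBlocks σ par c h j := by
        rw [← hpos]; exact blk_pos_mem_occBlocks σ par c h hm' (by rw [hd']; omega)
      exact hbocc _ (Or.inl rfl) hx1 this
    · intro heq
      have hpos : pos σ par c m' = slotVal σ (slotOf σ (pos σ par c p) - 1) := by rw [← heq, slotVal_slotOf σ hd']
      have : blk h (slotVal σ (slotOf σ (pos σ par c p) - 1)) ∈ occBlocks σ par c h j := by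
        rw [← hpos]; exact blk_pos_mem_occBlocks σ par c h hm' (by rw [hd']; omega)
      exact hbocc _ (Or.inr rfl) hx2 this
  have hsplit : ∀ m, m ≤ 2 * (j + 1) → m ≤ 2 * j ∨ (m = 2 * j + 1 ∨ m = 2 * j + 2) := fun m hm ↦ by omega
  have hnewexp : ∀ m, m = 2 * j + 1 ∨ m = 2 * j + 2 → ¬ ∃ i < j + 1, par[i]? = some m := by
    rintro m hm ⟨i, hi, hpi⟩
    rw [List.getElem?_eq_getElem (by omega)] at hpi
    have e1 : par[i] = m := Option.some.inj hpi
    have := hval.2 i (by omega)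
    omega
  -- assemble
  refine geomInv_succ_of I ?_ hfresh hdist ?_ ?_ ?_ ?_ ?_ ?_ ?_ ?_ ?_
  · intro m hm
    rw [hq m hm]
    rcases hnewpos m hm with h' | h' <;> rw [h']
    exacts [hmem0, hmem1]
  · intro m hm _
    have hlm : land σ par c m = m := land_of_isCross σ par c (hcross m hm)
    rw [hlm]
    exact ⟨by rw [hnewd m hm]; omega, hcross m hm, le_rfl, htdnew m hm, fun h' ↦ absurd rfl h', rfl⟩
  · intro m hm _ L hL hcL heq
    have := blk_pos_mem_occBlocks σ par c h hL (by rw [hcL.2.2]; omega)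
    exact hblknew m hm (heq ▸ this)
  · intro _ _
    rcases hnewslot _ (Or.inl rfl) with ha | ha <;> rcases hnewslot _ (Or.inr rfl) with hb | hb
    · exact absurd (ha.trans hb.symm) hdist
    · rw [ha, hb]; exact hbne'
    · rw [ha, hb]; exact hbne'.symm
    · exact absurd (ha.trans hb.symm) hdist
  · intro m hm _ a ha htda hdeepa heq
    apply hblknew m hm
    rw [heq]
    exact blk_aPos_mem_occBlocks σ par c h j ha htda hdeepa
  · intro m hm hum
    exact absurd hum (not_isUp_of_isCross (hcross m hm))
  · intro m hm _ hnc
    exact absurd (hcross m hm) hnc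
  · -- readIff
    intro m hm hd
    rw [hrev, Finset.mem_union, Finset.mem_insert, Finset.mem_insert, Finset.mem_singleton]
    rcases hsplit m hm with h' | h'
    · by_cases hmp : m = p
      · subst hmp
        simp only [true_or, or_true, true_iff]
        exact Or.inr ⟨j, by omega, by rw [List.getElem?_eq_getElem hj]⟩
      · obtain ⟨n1, n2⟩ := hnoold m h' hd
        have n0 : slotOf σ (pos σ par c m) ≠ slotOf σ (pos σ par c p) := fun heq ↦
          hmp (I.inj m h' p hp_le (slotOf_inj σ hd hv heq))
        simp only [n0, n1, n2, or_false]
        rw [I.readIff m h' hd]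
        apply or_congr_right
        constructor
        · rintro ⟨i, hi, hpi⟩; exact ⟨i, by omega, hpi⟩
        · rintro ⟨i, hi, hpi⟩
          rcases Nat.lt_succ_iff_lt_or_eq.mp hi with hlt | rfl
          · exact ⟨i, hlt, hpi⟩
          · exfalso
            rw [List.getElem?_eq_getElem hj] at hpi
            exact hmp (Option.some.inj hpi).symm
    · simp only [hcross m h', true_or, iff_true]
      rcases hnewslot m h' with h'' | h'' <;> rw [h'', slotOf_slotVal] <;> simp
  · -- readOcc
    intro s hs
    rw [hrev, Finset.mem_union, Finset.mem_insert, Finset.mem_insert, Finset.mem_singleton] at hs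
    rcases hs with hs | rfl | rfl | rfl
    · obtain ⟨m, hm, hd, hxm⟩ := I.readOcc s hs; exact ⟨m, by omega, hd, hxm⟩
    · exact ⟨p, by omega, hv, rfl⟩
    · -- a new node sits in slot `x + 1`
      rcases hnewslot _ (Or.inl rfl) with ha | ha
      · exact ⟨2 * j + 1, by omega, hnewd _ (Or.inl rfl), by rw [ha, slotOf_slotVal]⟩
      · rcases hnewslot _ (Or.inr rfl) with hb | hb
        · exact ⟨2 * j + 2, by omega, hnewd _ (Or.inr rfl), by rw [hb, slotOf_slotVal]⟩
        · exact absurd (ha.trans hb.symm) hdist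
    · -- a new node sits in slot `x - 1`
      rcases hnewslot _ (Or.inl rfl) with ha | ha
      · rcases hnewslot _ (Or.inr rfl) with hb | hb
        · exact absurd (ha.trans hb.symm) hdist
        · exact ⟨2 * j + 2, by omega, hnewd _ (Or.inr rfl), by rw [hb, slotOf_slotVal]⟩
      · exact ⟨2 * j + 1, by omega, hnewd _ (Or.inl rfl), by rw [ha, slotOf_slotVal]⟩
  · -- seg: a new segment around `x`
    obtain ⟨C, a, b, hab, hsep, hcov, hend⟩ := I.seg
    set x := slotOf σ (pos σ par c p) with hxdef
    have hxC : ∀ x' ∈ C, x' ∈ revSlots σ par c j := by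
      intro x' hx'
      rw [hcov]
      exact ⟨x', hx', 0, by have := (hab x' hx').1; omega, by have := (hab x' hx').2.2.1; omega, by simp⟩
    have hxne : ∀ x' ∈ C, x' ≠ x := fun x' hx' heq ↦ hx (heq ▸ hxC x' hx')
    refine ⟨insert x C, Function.update a x 1, Function.update b x 1, ?_, ?_, ?_, ?_⟩
    · intro x' hx'
      rw [Finset.mem_insert] at hx'
      rcases hx' with rfl | hx'
      · simp
      · rw [Function.update_of_ne (hxne x' hx'), Function.update_of_ne (hxne x' hx')]
        obtain ⟨a1', a2, b1, b2⟩ := hab x' hx'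
        exact ⟨a1', by omega, b1, by omega⟩
    · intro x' hx' x'' hx'' hne' d hd heq
      rw [Finset.mem_insert] at hx' hx''
      rcases hx' with rfl | hx' <;> rcases hx'' with rfl | hx''
      · exact hne' rfl
      · exact hfar x'' (hxC x'' hx'') d hd heq
      · apply hfar x' (hxC x' hx') (-d) (by rw [abs_neg]; exact hd)
        rw [heq, Int.cast_neg]; ring
      · exact hsep x' hx' x'' hx'' hne' d hd heq
    · intro s
      rw [hrev, Finset.mem_union, hcov, Finset.mem_insert, Finset.mem_insert, Finset.mem_singleton]
      constructor
      · rintro (⟨x', hx', d, hd1, hd2, rfl⟩ | rfl | rfl | rfl)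
        · refine ⟨x', Finset.mem_insert_of_mem hx', d, ?_, ?_, rfl⟩
          · rw [Function.update_of_ne (hxne x' hx')]; exact hd1
          · rw [Function.update_of_ne (hxne x' hx')]; exact hd2
        · exact ⟨x, Finset.mem_insert_self _ _, 0, by simp, by simp, by simp⟩
        · exact ⟨x, Finset.mem_insert_self _ _, 1, by simp, by simp, by push_cast; try ring⟩
        · exact ⟨x, Finset.mem_insert_self _ _, -1, by simp, by simp, by push_cast; try ring⟩
      · rintro ⟨x', hx', d, hd1, hd2, rfl⟩
        rw [Finset.mem_insert] at hx'
        rcases hx' with rfl | hx'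
        · simp only [Function.update_self, Nat.cast_one] at hd1 hd2
          right
          rcases (by omega : d = 0 ∨ d = 1 ∨ d = -1) with rfl | rfl | rfl
          · left; simp
          · right; left; push_cast; try ring
          · right; right; push_cast; try ring
        · left
          rw [Function.update_of_ne (hxne x' hx')] at hd1 hd2
          exact ⟨x', hx', d, hd1, hd2, rfl⟩
    · intro m hm hcm hne'
      rcases hsplit m hm with h' | h'
      · obtain ⟨x', hx', hor'⟩ := hend m h' hcm (fun ⟨i, hi, hpi⟩ ↦ hne' ⟨i, by omega, hpi⟩)
        refine ⟨x', Finset.mem_insert_of_mem hx', ?_⟩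
        rw [Function.update_of_ne (hxne x' hx'), Function.update_of_ne (hxne x' hx')]
        exact hor'
      · refine ⟨x, Finset.mem_insert_self _ _, ?_⟩
        simp only [Function.update_self, Nat.cast_one]
        rcases hnewslot m h' with h'' | h'' <;> rw [h'', slotOf_slotVal]
        · left; push_cast; try ring
        · right; push_cast; try ring

/-! ### Extension of a segment -/

include hn hval ht hN hh hj I hblock in
/-- **Induction step for a later crossing** (a pending cross node is expanded: one child climbs to
the parent vertex, the other crosses the cycle into the next slot outward, read for the first
time — the segment of read slots grows by one). [cite: ChildsEtAl2003, §4 (Lemma 8 (i), (ii))] -/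
theorem step_extension (hdeep : ¬ Deep σ par c h) (hpc : IsCross σ par c par[j]) :
    GeomInv σ par c t h (j + 1) := by
  obtain ⟨hp_le, hunexp, hpj, hq1, hq2⟩ := step_node hval hj
  set p := par[j] with hp
  have hE : 2 * j + 2 ≤ 2 * par.length := by omega
  have hjt : j + 1 ≤ t := by omega
  have hK : 2 * (2 * t + 4) < 2 ^ (n + 1) := by rw [Nat.pow_succ']; omega
  have hp0 : p ≠ 0 := hpc.1
  have hv : depth (pos σ par c p) = n := hpc.2.2
  have hvq : depth (pos σ par c (parentOf par p)) = n := hpc.2.1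
  have hpu : ¬ IsUp σ par c p := not_isUp_of_isCross hpc
  have htdp : n < tdepth par p := by
    by_contra hle
    exact not_isCross_of_tdepth_le σ hval.2 c (by omega) (not_lt.mp hle) hpc
  have hup0 : upCount σ par c p = 0 := upCount_eq_zero σ hval.2 c (by omega) hpu
  have hlp : land σ par c p = p := land_of_isCross σ par c hpc
  -- the parent node: expanded before `j`, at a leaf in an adjacent read slot
  obtain ⟨hpeq, hqlt⟩ := parentOf_lt hval.2 (Nat.one_le_iff_ne_zero.mpr hp0) (show p ≤ 2 * par.length by omega)
  have hq_le : parentOf par p ≤ 2 * j := by omega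
  have hqexp : ∃ i < j, par[i]? = some (parentOf par p) :=
    ⟨(p - 1) / 2, by omega, by rw [List.getElem?_eq_getElem (by omega), hpeq]⟩
  have hx : slotOf σ (pos σ par c p) ∈ revSlots σ par c j := (I.readIff p hp_le hv).mpr (Or.inl hpc)
  have hxq : slotOf σ (pos σ par c (parentOf par p)) ∈ revSlots σ par c j :=
    (I.readIff _ hq_le hvq).mpr (Or.inr hqexp)
  have hadj : slotOf σ (pos σ par c (parentOf par p)) = slotOf σ (pos σ par c p) + 1 ∨
      slotOf σ (pos σ par c (parentOf par p)) = slotOf σ (pos σ par c p) - 1 := by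
    rcases slotOf_adj_of_leaf_nbr hn σ hvq hv (I.nbr p (Nat.one_le_iff_ne_zero.mpr hp0) hp_le) with h' | h'
    · right; rw [h']; ring
    · left; rw [h']; ring
  obtain ⟨hbocc, -⟩ := not_badBlock_imp hblock (by rw [hpj]; exact hv)
  rw [hpj] at hbocc
  -- the segment at whose end `x` sits, and the outer neighbour `y`
  obtain ⟨C, a, b, hab, hsep, hcov, hend⟩ := I.seg
  obtain ⟨xc, hxc, hxend⟩ := hend p hp_le hpc hunexp
  set x := slotOf σ (pos σ par c p) with hxdef
  obtain ⟨ha1, haj, hb1, hbj⟩ := hab xc hxc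
  have hout : ∀ e : ℤ, (e = (b xc : ℤ) + 1 ∨ e = -(a xc : ℤ) - 1) → xc + (e : Slot n) ∉ revSlots σ par c j := by
    intro e he hmem
    obtain ⟨x', hx', d, hd1, hd2, heq⟩ := (hcov _).mp hmem
    obtain ⟨-, haj', -, hbj'⟩ := hab x' hx'
    by_cases hxx : x' = xc
    · rw [hxx] at heq hd1 hd2
      have := slot_int_offset_inj hK (abs_le.mpr ⟨by omega, by omega⟩) (abs_le.mpr ⟨by omega, by omega⟩) heq
      omega
    · refine hsep xc hxc x' hx' (Ne.symm hxx) (e - d) (abs_le.mpr ⟨by omega, by omega⟩) ?_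
      rw [eq_sub_of_add_eq heq.symm]; push_cast; ring
  obtain ⟨y, inr, a', b', hyi, hy, hP1, hP2, hP3, hP4, hP5⟩ : ∃ (y inr : Slot n) (a' b' : Slot n → ℕ),
      ((y = x + 1 ∧ inr = x - 1) ∨ (y = x - 1 ∧ inr = x + 1)) ∧ y ∉ revSlots σ par c j ∧
      (∀ x', x' ≠ xc → a' x' = a x' ∧ b' x' = b x') ∧
      (1 ≤ a' xc ∧ a' xc ≤ j + 2 ∧ 1 ≤ b' xc ∧ b' xc ≤ j + 2) ∧
      (∀ s : Slot n, (∃ d : ℤ, -(a' xc : ℤ) ≤ d ∧ d ≤ b' xc ∧ s = xc + d) ↔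
        (∃ d : ℤ, -(a xc : ℤ) ≤ d ∧ d ≤ b xc ∧ s = xc + d) ∨ s = y) ∧
      (y = xc + ((b' xc : ℕ) : ℤ) ∨ y = xc + (-((a' xc : ℕ) : ℤ))) ∧
      (∀ s : Slot n, (s = xc + ((b xc : ℕ) : ℤ) ∨ s = xc + (-((a xc : ℕ) : ℤ))) → s ≠ x →
        (s = xc + ((b' xc : ℕ) : ℤ) ∨ s = xc + (-((a' xc : ℕ) : ℤ)))) := by
    rcases hxend with hxe | hxe
    · -- `x` is the right end: `y = x + 1`
      refine ⟨x + 1, x - 1, a, Function.update b xc (b xc + 1), Or.inl ⟨rfl, rfl⟩, ?_, ?_, ?_, ?_, ?_, ?_⟩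
      · intro hmem
        rw [show x + 1 = xc + (((b xc : ℤ) + 1 : ℤ) : Slot n) by rw [hxe]; push_cast; ring] at hmem
        exact hout _ (Or.inl rfl) hmem
      · intro x' hx'; exact ⟨rfl, by rw [Function.update_of_ne hx']⟩
      · simp only [Function.update_self]; omega
      · intro s
        simp only [Function.update_self]
        constructor
        · rintro ⟨d, hd1, hd2, rfl⟩
          by_cases hdb : d ≤ (b xc : ℤ)
          · exact Or.inl ⟨d, hd1, hdb, rfl⟩
          · right
            have : d = (b xc : ℤ) + 1 := by push_cast at hd2; omega
            rw [this, hxe]; push_cast; ring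
        · rintro (⟨d, hd1, hd2, rfl⟩ | rfl)
          · exact ⟨d, hd1, by push_cast; omega, rfl⟩
          · exact ⟨(b xc : ℤ) + 1, by omega, by push_cast; omega, by rw [hxe]; push_cast; ring⟩
      · left; simp only [Function.update_self]; rw [hxe]; push_cast; ring
      · intro s hs hsx
        simp only [Function.update_self]
        rcases hs with hs | hs
        · exact absurd (hs.trans hxe.symm) hsx
        · exact Or.inr hs
    · -- `x` is the left end: `y = x - 1`
      refine ⟨x - 1, x + 1, Function.update a xc (a xc + 1), b, Or.inr ⟨rfl, rfl⟩, ?_, ?_, ?_, ?_, ?_, ?_⟩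
      · intro hmem
        rw [show x - 1 = xc + ((-(a xc : ℤ) - 1 : ℤ) : Slot n) by rw [hxe]; push_cast; ring] at hmem
        exact hout _ (Or.inr rfl) hmem
      · intro x' hx'; exact ⟨by rw [Function.update_of_ne hx'], rfl⟩
      · simp only [Function.update_self]; omega
      · intro s
        simp only [Function.update_self]
        constructor
        · rintro ⟨d, hd1, hd2, rfl⟩
          by_cases hda : -(a xc : ℤ) ≤ d
          · exact Or.inl ⟨d, hda, hd2, rfl⟩
          · right
            have : d = -(a xc : ℤ) - 1 := by push_cast at hd1; omega
            rw [this, hxe]; push_cast; ring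
        · rintro (⟨d, hd1, hd2, rfl⟩ | rfl)
          · exact ⟨d, by push_cast; omega, hd2, rfl⟩
          · exact ⟨-(a xc : ℤ) - 1, by push_cast; omega, by omega, by rw [hxe]; push_cast; ring⟩
      · right; simp only [Function.update_self]; rw [hxe]; push_cast; ring
      · intro s hs hsx
        simp only [Function.update_self]
        rcases hs with hs | hs
        · exact Or.inl hs
        · exact absurd (hs.trans hxe.symm) hsx
  -- the inner slot is the parent's
  have hsq : slotOf σ (pos σ par c (parentOf par p)) = inr := by
    rcases hyi with ⟨hy1, hi1⟩ | ⟨hy1, hi1⟩ <;> rcases hadj with h' | h'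
    · exfalso; apply hy; rw [hy1, ← h']; exact hxq
    · rw [h', hi1]
    · rw [h', hi1]
    · exfalso; apply hy; rw [hy1, ← h']; exact hxq
  have hposq : pos σ par c (parentOf par p) = slotVal σ inr := by rw [← hsq, slotVal_slotOf σ hvq]
  have hyalt : y = x + 1 ∨ y = x - 1 := by
    rcases hyi with ⟨h', -⟩ | ⟨h', -⟩; exacts [Or.inl h', Or.inr h']
  have hinr_mem : inr ∈ revSlots σ par c j := hsq ▸ hxq
  -- the options: up to the parent vertex, or across to the leaf in slot `y`
  have hos : stepOpts σ (pos σ par c p) (if p = 0 then none else some (pos σ par c (parentOf par p))) =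
      [parentV (pos σ par c p), slotVal σ y] := by
    rw [if_neg hp0, hposq]
    apply stepOpts_slotVal_adj hn σ hv
    rcases hyi with ⟨h1', h2'⟩ | ⟨h1', h2'⟩
    · exact Or.inr ⟨h2', h1'⟩
    · exact Or.inl ⟨h2', h1'⟩
  obtain ⟨hne, hnewpos, hor, hmem0, hmem1⟩ := step_children_of_eq hn σ hval c hh hj I hos
  have hq : ∀ m, m = 2 * j + 1 ∨ m = 2 * j + 2 → parentOf par m = p := by
    rintro m (rfl | rfl); exacts [hq1, hq2]
  have hm0 : ∀ m, m = 2 * j + 1 ∨ m = 2 * j + 2 → m ≠ 0 := by rintro m (rfl | rfl) <;> omega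
  have htd : ∀ m, m = 2 * j + 1 ∨ m = 2 * j + 2 → tdepth par m = tdepth par p + 1 := by
    rintro m (rfl | rfl)
    · exact (tdepth_child hval.2 hj).1
    · exact (tdepth_child hval.2 hj).2
  have htdnew : ∀ m, m = 2 * j + 1 ∨ m = 2 * j + 2 → n < tdepth par m := by
    intro m hm; rw [htd m hm]; omega
  -- the up child
  have hdepU : depth (parentV (pos σ par c p)) = n - 1 := by rw [depth_parentV, hv]
  have hU_up : ∀ m, m = 2 * j + 1 ∨ m = 2 * j + 2 → pos σ par c m = parentV (pos σ par c p) →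
      IsUp σ par c m ∧ upCount σ par c m = 1 ∧ ¬ IsCross σ par c m ∧ land σ par c m = p := by
    intro m hm hpm
    have hum : IsUp σ par c m := ⟨hm0 m hm, by rw [hq m hm, hv]; exact hn, by rw [hq m hm]; exact hpm⟩
    have hncm : ¬ IsCross σ par c m := fun hc ↦ not_isUp_of_isCross hc hum
    refine ⟨hum, ?_, hncm, ?_⟩
    · rw [upCount_eq_succ σ hval.2 c (by rcases hm with rfl | rfl <;> omega) hum, hq m hm, hup0]
    · rw [land_of_not_isCross σ par c (hm0 m hm) hncm (by rw [hq m hm]; rcases hm with rfl | rfl <;> omega),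
        hq m hm, hlp]
  have h2 : 2 ≤ h := by
    by_contra hlt
    rcases hor with ⟨h0, -⟩ | ⟨-, h0⟩
    · obtain ⟨-, hcnt, -⟩ := hU_up _ (Or.inl rfl) h0
      exact hdeep ⟨2 * j + 1, by omega, by rw [hcnt]; omega⟩
    · obtain ⟨-, hcnt, -⟩ := hU_up _ (Or.inr rfl) h0
      exact hdeep ⟨2 * j + 2, by omega, by rw [hcnt]; omega⟩
  have hdeep_U : n + 1 - h ≤ depth (parentV (pos σ par c p)) := by rw [hdepU]; omega
  have hblk_U : blk h (parentV (pos σ par c p)) = blk h (pos σ par c p) := blk_parentV (by rw [hv]; omega)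
  -- the cross child
  have hY_cross : ∀ m, m = 2 * j + 1 ∨ m = 2 * j + 2 → pos σ par c m = slotVal σ y →
      IsCross σ par c m ∧ ¬ IsUp σ par c m ∧ land σ par c m = m := by
    intro m hm hpm
    have hcm : IsCross σ par c m := ⟨hm0 m hm, by rw [hq m hm]; exact hv, by rw [hpm, depth_slotVal]⟩
    exact ⟨hcm, not_isUp_of_isCross hcm, land_of_isCross σ par c hcm⟩
  have hblk_Y : blk h (slotVal σ y) ∉ occBlocks σ par c h j := hbocc y hyalt hy
  have hUY : ∀ m, m = 2 * j + 1 ∨ m = 2 * j + 2 →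
      (pos σ par c m = parentV (pos σ par c p) ∧ IsUp σ par c m ∧ ¬ IsCross σ par c m) ∨
      (pos σ par c m = slotVal σ y ∧ IsCross σ par c m ∧ ¬ IsUp σ par c m) := by
    intro m hm
    rcases hnewpos m hm with h' | h'
    · obtain ⟨hu', -, hc', -⟩ := hU_up m hm h'; exact Or.inl ⟨h', hu', hc'⟩
    · obtain ⟨hc', hu', -⟩ := hY_cross m hm h'; exact Or.inr ⟨h', hc', hu'⟩
  -- freshness
  have hfresh : ∀ m, m = 2 * j + 1 ∨ m = 2 * j + 2 → ∀ m' ≤ 2 * j, pos σ par c m ≠ pos σ par c m' := by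
    intro m hm m' hm' heq
    rcases hnewpos m hm with h' | h'
    · -- the up child at `parentV (pos p)`
      rw [h'] at heq
      by_cases htdm' : tdepth par m' ≤ n
      · obtain ⟨hposm', -, -, -⟩ := regionA σ hval.2 c m' (by omega) htdm'
        have hdeep' : n + 1 - h ≤ depth (aPos (n := n) par c m') := by rw [← hposm', ← heq]; exact hdeep_U
        apply I.landA p hp_le hpc m' (by omega) htdm' hdeep'
        rw [← hposm', ← heq, hblk_U]
      · obtain ⟨-, hcl', hlm', -, -, hblk'⟩ := I.nonA m' hm' (by omega)
        have hLL : land σ par c m' = p := by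
          by_contra hne'
          apply I.landBlk _ (by omega) p hp_le hcl' hpc hne'
          rw [← hblk', ← heq, hblk_U]
        by_cases hc' : IsCross σ par c m'
        · have hm'p : m' = p := by rw [← land_of_isCross σ par c hc', hLL]
          have := congrArg depth heq
          rw [hdepU, hm'p, hv] at this
          omega
        · by_cases hu' : IsUp σ par c m'
          · obtain ⟨-, hposu, hparu⟩ := I.up m' hm' hu'
            rw [hLL] at hposu hparu
            have hcm' : upCount σ par c m' < h := by
              by_contra hge; exact hdeep ⟨m', by omega, not_lt.mp hge⟩
            have hcnt : upCount σ par c m' = 1 := by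
              apply anc_injective_of_le (v := pos σ par c p) (by rw [hv]; omega) (by rw [hv]; omega)
              rw [← hposu, ← heq]; rfl
            have hm'1 : 1 ≤ m' := Nat.one_le_iff_ne_zero.mpr hu'.1
            obtain ⟨hpeq', hlt'⟩ := parentOf_lt hval.2 hm'1 (by omega : m' ≤ 2 * par.length)
            have hqm : parentOf par m' = p := by
              rcases hparu with hqu | hqL
              · have e1 := upCount_eq_succ σ hval.2 c (by omega) hu'
                have e2 := upCount_eq_succ σ hval.2 c (by omega) hqu
                omega
              · exact hqL
            apply hunexp
            refine ⟨(m' - 1) / 2, by omega, ?_⟩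
            rw [List.getElem?_eq_getElem (by omega), ← hpeq', hqm]
          · obtain ⟨-, -, -, -, -, r', hr'1, hr'h, hdesc'⟩ := I.down m' hm' (by omega) hc' hu'
            rw [hLL, ← heq] at hdesc'
            exact not_isDesc_sib_anc hr'1 (by rw [hv]; omega) (by rw [hv]) 1 hdesc'
    · -- the cross child at `slotVal y`: its block is untouched
      apply hblk_Y
      rw [← h', heq]
      exact blk_pos_mem_occBlocks σ par c h hm' (by rw [← heq, h', depth_slotVal]; omega)
  have hdist : pos σ par c (2 * j + 1) ≠ pos σ par c (2 * j + 2) := by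
    rcases hor with ⟨h0, h1'⟩ | ⟨h0, h1'⟩ <;> rw [h0, h1']; exacts [hne, hne.symm]
  -- the new read set: only `y` is new
  have hrev : ∀ s, s ∈ revSlots σ par c (j + 1) ↔ s ∈ revSlots σ par c j ∨ s = y := by
    intro s
    rw [revSlots_succ, hpj, if_pos hv, Finset.mem_union, Finset.mem_insert, Finset.mem_insert,
      Finset.mem_singleton]
    constructor
    · rintro (hs | rfl | rfl | rfl)
      · exact Or.inl hs
      · exact Or.inl hx
      · rcases hyi with ⟨hy1, hi1⟩ | ⟨hy1, hi1⟩
        · exact Or.inr hy1.symm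
        · exact Or.inl (by rw [← hi1]; exact hinr_mem)
      · rcases hyi with ⟨hy1, hi1⟩ | ⟨hy1, hi1⟩
        · exact Or.inl (by rw [← hi1]; exact hinr_mem)
        · exact Or.inr hy1.symm
    · rintro (hs | rfl)
      · exact Or.inl hs
      · rcases hyalt with h' | h'
        · exact Or.inr (Or.inr (Or.inl h'))
        · exact Or.inr (Or.inr (Or.inr h'))
  have hsplit : ∀ m, m ≤ 2 * (j + 1) → m ≤ 2 * j ∨ (m = 2 * j + 1 ∨ m = 2 * j + 2) := fun m hm ↦ by omega
  -- assemble
  refine geomInv_succ_of I ?_ hfresh hdist ?_ ?_ ?_ ?_ ?_ ?_ ?_ ?_ ?_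
  · intro m hm
    rw [hq m hm]
    rcases hnewpos m hm with h' | h' <;> rw [h']
    exacts [hmem0, hmem1]
  · intro m hm _
    rcases hUY m hm with ⟨hpm, -, -⟩ | ⟨hpm, hcm, -⟩
    · obtain ⟨-, -, -, hlm⟩ := hU_up m hm hpm
      rw [hlm, hpm]
      refine ⟨hdeep_U, hpc, by rcases hm with rfl | rfl <;> omega, htdp,
        fun _ ↦ ⟨j, by rcases hm with rfl | rfl <;> omega, by rw [List.getElem?_eq_getElem hj]⟩, hblk_U⟩
    · obtain ⟨-, -, hlm⟩ := hY_cross m hm hpm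
      rw [hlm, hpm]
      exact ⟨by rw [depth_slotVal]; omega, hcm, le_rfl, htdnew m hm, fun h' ↦ absurd rfl h', rfl⟩
  · intro m hm hcm L hL hcL heq
    rcases hUY m hm with ⟨-, -, hncm⟩ | ⟨hpm, -, -⟩
    · exact hncm hcm
    · have := blk_pos_mem_occBlocks σ par c h hL (by rw [hcL.2.2]; omega)
      rw [← heq, hpm] at this
      exact hblk_Y this
  · intro hc1 hc2
    exfalso
    rcases hor with ⟨h0, -⟩ | ⟨-, h0⟩
    · exact (hU_up _ (Or.inl rfl) h0).2.2.1 hc1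
    · exact (hU_up _ (Or.inr rfl) h0).2.2.1 hc2
  · intro m hm hcm a₀ ha htda hdeepa heq
    rcases hUY m hm with ⟨-, -, hncm⟩ | ⟨hpm, -, -⟩
    · exact hncm hcm
    · apply hblk_Y
      rw [← hpm, heq]
      exact blk_aPos_mem_occBlocks σ par c h j ha htda hdeepa
  · intro m hm hum
    rcases hUY m hm with ⟨hpm, -, -⟩ | ⟨-, -, hnum⟩
    · obtain ⟨-, hcnt, -, hlm⟩ := hU_up m hm hpm
      refine ⟨htdnew m hm, ?_, Or.inr (by rw [hq m hm, hlm])⟩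
      rw [hlm, hcnt, hpm]; rfl
    · exact absurd hum hnum
  · intro m hm _ hncm hnum
    rcases hUY m hm with ⟨-, hum, -⟩ | ⟨-, hcm, -⟩
    · exact absurd hum hnum
    · exact absurd hcm hncm
  · -- readIff
    intro m hm hd
    rw [hrev]
    rcases hsplit m hm with h' | h'
    · by_cases hmp : m = p
      · subst hmp
        exact iff_of_true (Or.inl hx) (Or.inl hpc)
      · have hny : slotOf σ (pos σ par c m) ≠ y := by
          intro heq
          apply hblk_Y
          rw [← heq, slotVal_slotOf σ hd]
          exact blk_pos_mem_occBlocks σ par c h h' (by rw [hd]; omega)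
        simp only [hny, or_false]
        rw [I.readIff m h' hd]
        apply or_congr_right
        constructor
        · rintro ⟨i, hi, hpi⟩; exact ⟨i, by omega, hpi⟩
        · rintro ⟨i, hi, hpi⟩
          rcases Nat.lt_succ_iff_lt_or_eq.mp hi with hlt | rfl
          · exact ⟨i, hlt, hpi⟩
          · exfalso
            rw [List.getElem?_eq_getElem hj] at hpi
            exact hmp (Option.some.inj hpi).symm
    · rcases hUY m h' with ⟨hpm, -, -⟩ | ⟨hpm, hcm, -⟩
      · exfalso; rw [hpm, hdepU] at hd; omega
      · exact iff_of_true (Or.inr (by rw [hpm, slotOf_slotVal])) (Or.inl hcm)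
  · -- readOcc
    intro s hs
    rcases (hrev s).mp hs with hs | rfl
    · obtain ⟨m, hm, hd, hxm⟩ := I.readOcc s hs; exact ⟨m, by omega, hd, hxm⟩
    · rcases hor with ⟨-, h0⟩ | ⟨h0, -⟩
      · exact ⟨2 * j + 2, by omega, by rw [h0, depth_slotVal], by rw [h0, slotOf_slotVal]⟩
      · exact ⟨2 * j + 1, by omega, by rw [h0, depth_slotVal], by rw [h0, slotOf_slotVal]⟩
  · -- seg: the segment of `xc` grows by one slot
    refine ⟨C, a', b', ?_, hsep, ?_, ?_⟩
    · intro x' hx'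
      by_cases hxx : x' = xc
      · rw [hxx]; omega
      · obtain ⟨e1, e2⟩ := hP1 x' hxx
        rw [e1, e2]
        obtain ⟨a1', a2, b1, b2⟩ := hab x' hx'
        exact ⟨a1', by omega, b1, by omega⟩
    · intro s
      rw [hrev s, hcov s]
      constructor
      · rintro (⟨x', hx', d, hd1, hd2, rfl⟩ | hsy)
        · by_cases hxx : x' = xc
          · obtain ⟨d', hd1', hd2', he'⟩ := (hP3 (x' + d)).mpr
              (Or.inl ⟨d, by rw [← hxx]; exact hd1, by rw [← hxx]; exact hd2, by rw [hxx]⟩)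
            exact ⟨xc, hxc, d', hd1', hd2', he'⟩
          · obtain ⟨e1, e2⟩ := hP1 x' hxx
            exact ⟨x', hx', d, by rw [e1]; exact hd1, by rw [e2]; exact hd2, rfl⟩
        · obtain ⟨d', hd1', hd2', he'⟩ := (hP3 s).mpr (Or.inr hsy)
          exact ⟨xc, hxc, d', hd1', hd2', he'⟩
      · rintro ⟨x', hx', d, hd1, hd2, rfl⟩
        by_cases hxx : x' = xc
        · rcases (hP3 (x' + d)).mp ⟨d, by rw [← hxx]; exact hd1, by rw [← hxx]; exact hd2, by rw [hxx]⟩ with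
            ⟨d', hd1', hd2', he'⟩ | hy'
          · exact Or.inl ⟨xc, hxc, d', hd1', hd2', he'⟩
          · exact Or.inr hy'
        · obtain ⟨e1, e2⟩ := hP1 x' hxx
          exact Or.inl ⟨x', hx', d, by rw [← e1]; exact hd1, by rw [← e2]; exact hd2, rfl⟩
    · intro m hm hcm hne'
      rcases hsplit m hm with h' | h'
      · have hmp : m ≠ p := by
          rintro rfl
          exact hne' ⟨j, by omega, by rw [List.getElem?_eq_getElem hj]⟩
        obtain ⟨x', hx', hor'⟩ := hend m h' hcm (fun ⟨i, hi, hpi⟩ ↦ hne' ⟨i, by omega, hpi⟩)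
        refine ⟨x', hx', ?_⟩
        by_cases hxx : x' = xc
        · rw [hxx] at hor' ⊢
          exact hP5 _ hor' (fun heq ↦ hmp (I.inj m h' p hp_le (slotOf_inj σ hcm.2.2 hv heq)))
        · obtain ⟨e1, e2⟩ := hP1 x' hxx
          rw [e1, e2]; exact hor'
      · rcases hUY m h' with ⟨-, -, hncm⟩ | ⟨hpm, -, -⟩
        · exact absurd hcm hncm
        · refine ⟨xc, hxc, ?_⟩
          rw [hpm, slotOf_slotVal]
          exact hP4

end Step

end GluedTrees

end Literature.Computability.QuantumComplexity

/-!
# Glued trees, Theorem 9 (classical lower bound) — XVI: geometry of the embedding, conclusion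

Theorem-only support file for `ChildsEtAl2003_thm9` (rigorous Lemma 8, geometric half): the
induction on the expansions is assembled from the four step lemmas (`step_inner`, `step_up`,
`step_creation`, `step_extension`), giving `GeomInv` at every stage, and in particular

* `proper_of_good`: if the embedding never climbs `h` levels in a row after a crossing (`¬ Deep`)
  and no expansion triggers the spread or block events (`¬ BadSpread`, `¬ BadBlock`), then the
  embedding is proper (all positions distinct).

## References

* [ChildsEtAl2003] A. M. Childs et al., Exponential algorithmic speedup by a quantum walk,
  STOC 2003, §4, Lemma 8.
-/

open Literature.Computability.Complexity

namespace Literature.Computability.QuantumComplexity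

namespace GluedTrees

open Finset

variable {n : ℕ}

/-- **One expansion preserves the invariant** (case analysis on the kind of the expanded node).
[cite: ChildsEtAl2003, §4 (Lemma 8)] -/
theorem geomInv_succ (hn : 1 ≤ n) (σ : CycleDatum n) {par : List ℕ} (hval : ValidPar par) (c : ℕ → Bool)
    {t h : ℕ} (ht : par.length ≤ t) (hN : 4 * t + 10 ≤ 2 ^ n) (h2 : 2 ≤ h) (hh : h ≤ n) {j : ℕ}
    (hj : j < par.length) (I : GeomInv σ par c t h j) (hdeep : ¬ Deep σ par c h)
    (hspread : ¬ BadSpread σ par c t j) (hblock : ¬ BadBlock σ par c h j) : GeomInv σ par c t h (j + 1) := by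
  obtain ⟨hp_le, -, -, -, -⟩ := step_node hval hj
  have h1 : 1 ≤ h := by omega
  by_cases hp0 : par[j] = 0
  · have htd0 : tdepth par par[j] ≤ n := by rw [hp0, tdepth_zero]; omega
    obtain ⟨-, hd, -, -⟩ := regionA σ hval.2 c par[j] (by omega) htd0
    refine step_inner hn σ hval c hh hj I ?_ (Or.inl hp0) (Or.inl htd0)
    rw [hd, hp0, tdepth_zero]; omega
  by_cases htdA : tdepth par par[j] ≤ n
  · obtain ⟨-, -, -, hmove⟩ := regionA σ hval.2 c par[j] (by omega) htdA
    obtain ⟨hdq, hch⟩ := hmove hp0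
    have hu : pos σ par c (parentOf par par[j]) = parentV (pos σ par c par[j]) := by
      rw [hch, parentV_childV hdq]
    rcases (show depth (pos σ par c par[j]) < n ∨ depth (pos σ par c par[j]) = n by
        have := depth_le (pos σ par c par[j]); omega) with hlt | heqn
    · exact step_inner hn σ hval c hh hj I hlt (Or.inr hu) (Or.inl htdA)
    · exact step_creation hn σ hval c hN h1 hh hj I hspread hblock heqn hu hp0 (Or.inl htdA)
  · have htdp : n < tdepth par par[j] := not_le.mp htdA
    by_cases hpc : IsCross σ par c par[j]
    · exact step_extension hn σ hval c ht hN hh hj I hblock hdeep hpc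
    · by_cases hpu : IsUp σ par c par[j]
      · exact step_up hn σ hval c hh hj I hdeep hpu
      · obtain ⟨-, hpar, -, -⟩ := I.down par[j] hp_le htdp hpc hpu
        rcases (show depth (pos σ par c par[j]) < n ∨ depth (pos σ par c par[j]) = n by
            have := depth_le (pos σ par c par[j]); omega) with hlt | heqn
        · exact step_inner hn σ hval c hh hj I hlt (Or.inr hpar.symm) (Or.inr ⟨htdp, hpc, hpu⟩)
        · exact step_creation hn σ hval c hN h1 hh hj I hspread hblock heqn hpar.symm hp0
            (Or.inr ⟨htdp, hpc, hpu⟩)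

/-- **The invariant holds at every stage** of a good embedding. [cite: ChildsEtAl2003, §4 (Lemma 8)] -/
theorem geomInv_all (hn : 1 ≤ n) (σ : CycleDatum n) {par : List ℕ} (hval : ValidPar par) (c : ℕ → Bool)
    {t h : ℕ} (ht : par.length ≤ t) (hN : 4 * t + 10 ≤ 2 ^ n) (h2 : 2 ≤ h) (hh : h ≤ n)
    (hdeep : ¬ Deep σ par c h) (hgood : ∀ j < par.length, ¬ BadSpread σ par c t j ∧ ¬ BadBlock σ par c h j) :
    ∀ j ≤ par.length, GeomInv σ par c t h j := by
  intro j hj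
  induction j with
  | zero => exact geomInv_zero σ par c t h
  | succ j ih =>
    exact geomInv_succ hn σ hval c ht hN h2 hh (by omega) (ih (by omega)) hdeep (hgood j (by omega)).1
      (hgood j (by omega)).2

/-- **Rigorous Lemma 8, geometric half.** An embedding of a valid tree with at most `t` expansions
(`4t + 10 ≤ 2^n`, height parameter `2 ≤ h ≤ n`) that never climbs `h` levels in a row after a
crossing and triggers no spread or block event is PROPER. [cite: ChildsEtAl2003, §4 (Lemma 8)] -/
theorem proper_of_good (hn : 1 ≤ n) (σ : CycleDatum n) {par : List ℕ} (hval : ValidPar par) (c : ℕ → Bool)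
    {t h : ℕ} (ht : par.length ≤ t) (hN : 4 * t + 10 ≤ 2 ^ n) (h2 : 2 ≤ h) (hh : h ≤ n)
    (hdeep : ¬ Deep σ par c h) (hgood : ∀ j < par.length, ¬ BadSpread σ par c t j ∧ ¬ BadBlock σ par c h j) :
    Proper σ par c := by
  have I := geomInv_all hn σ hval c ht hN h2 hh hdeep hgood par.length le_rfl
  intro m hm m' hm' heq
  exact I.inj m hm m' hm' heq

end GluedTrees

end Literature.Computability.QuantumComplexity
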